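import Literature.MathematicalPhysics.QuantumFieldTheory.QCDSlab
import Literature.MathematicalPhysics.QuantumLattice.TwistedBoundaryConditions
import Mathlib.Analysis.SpecialFunctions.Complex.CircleAddChar
import HarnessLib

/-!
# Lattice QCD on the anisotropic torus `ℤ_T × (ℤ/S)³` with 't Hooft twisted boundary conditions
# on all six coordinate planes, colour–flavour-twisted Wilson quarks, and the electric-flux
# projection: `twistedSlabExpect`, `fluxProjectedSlabExpect`

Definition file (D-0014 / D-0026: definitions with bodies and proved API only; no named fact),
definition request D4 `defn-twistedSlabExpect` of route `FemtoStepScaling` of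
`Summits/QuantumFields/QCD`. It is the twisted twin of
`Literature.MathematicalPhysics.QuantumFieldTheory.qcdSlabExpect` (`QCDSlab.lean`): the same links
(`FiniteTemperature.Config 3 T S SU(3)` of Borgs–Seiler's finite-temperature lattice, time extent `T`,
spatial side `S`), the same Berezin-integrated time-antiperiodic Wilson quarks, but

* the Wilson gauge weight carries an **'t Hooft twist on every coordinate plane** of the
  anisotropic four-torus — the three temporal planes `(0, i)` and the three spatial planes `(i, j)`,
  `i < j` — in the twist-in-the-action form of
  `Literature.MathematicalPhysics.QuantumLattice.twistedHolonomy` (`TwistedBoundaryConditions.lean`,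
  hypercubic torus): the ONE corner plaquette of each plane and each transverse position (both
  in-plane coordinates equal to `−1`; for a temporal plane: `t = −1` and `x_i = −1`) enters the
  action as `Re tr ρ(z_P⁻¹ U_P)`, `z_P ∈ Z(G)` the twist of the plane, every other plaquette as
  `Re tr ρ(U_P)` ("`z_{μν}(n)` is equal to 1 except for the corner plaquettes in each plane",
  García Pérez–González-Arroyo–Okawa 2014 §6; the twist tensor `n_{μν}`, `n_{ij} = ε_{ijk} m_k`
  magnetic, `n_{0i} = k_i` the temporal twist, 't Hooft 1979 §2, de Forcrand–von Smekal 2002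
  §"Twisted boundary conditions and electric fluxes"); for `SU(N)` the twist of a plane with twist
  tensor entry `n_P ∈ ℤ/N` is the centre element `suCenter N n_P = e^{2πi n_P/N}·1`, so the corner
  plaquette carries the phase `centerPhase N (−n_P) = e^{−2πi n_P/N}` in the fundamental
  representation;
* the quark hopping terms that cross the seam `x_μ = −1 → 0` of a direction `μ` rotate the flavour
  index by a flavour matrix `F_μ` (forward) / `F_μ⁻¹` (backward) — the slab transplant of
  `Literature.MathematicalPhysics.QuantumLattice.flavourTwistedWilsonDirac`
  (`CPeriodicBoundaryConditions.lean`): fundamental quarks are single valued on the 't Hooft-twisted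
  torus only if `N_f ≡ 0 mod N` flavour ("smell") indices rotate with twist matrices eating the
  conjugate twist (Parisi; Lin–Ogawa–Ramos 2015 §2.1), and after the colour twist matrices are
  absorbed into the boundary links only this flavour rotation survives; the flavour twist
  `F : FiniteTemperature.Dir 3 → Matrix (Fin N_f) (Fin N_f) ℂ` is DATA of the functional (no twist
  eaters are constructed here), masses are flavour-diagonal `m_f` (for a genuine colour–flavour
  twist, which mixes flavours, take them degenerate, as the route does);
* the **electric-flux projection** ('t Hooft 1979 §2; van Baal 2001 §3.1: the electric flux
  `e ∈ ℤ_N³` labels the characters `Ψ([h_k]A) = e^{2πi e·k/N} Ψ(A)` of the `ℤ_N³` of twisted gauge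
  transformations `h_k`; on the Euclidean lattice `Tr(ĥ_k e^{−TH})` is the functional integral with
  temporal twist `n_{0i} = k_i`, so the ensemble of electric flux `e` at magnetic flux `m` is the
  `ℤ_N`-Fourier transform over the temporal twists,
  `e^{−F(e,m)/T} = N⁻³ Σ_k e^{−2πi e·k/N} Z(k, m)`, de Forcrand–von Smekal 2002 eq. for
  `e^{−F(e⃗,m⃗,θ)/T}` and `Z_e(e⃗) = Σ_k e^{−2πi e⃗·k⃗/N} Z_k(k⃗) / Σ_k Z_k(k⃗)`):
  `fluxProjectedSlabExpect β T S m e Φ mq X = (Σ_k χ_e(k)⁻¹ I_{(k,m)}(X)) / (Σ_k χ_e(k)⁻¹ I_{(k,m)}(1))`,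
  `χ_e(k) = e^{2πi k·e/3}`, `I_n(X)` the UNNORMALISED twisted functional `twistedSlabIntegral`
  (`= Z_n ⟨X⟩_n`), summed over all temporal twists `k : Fin 3 → ZMod 3` at fixed spatial twist `m`
  (the flavour twist may depend on `k`: a family `Φ k`); and the PARTIAL projection along one
  spatial direction `i` (`partialFluxProjectedSlabExpect`: average over `k_i ∈ ℤ₃` only, with the
  character `e^{−2πi k_i e_i/3}`, all other twists of a base tensor `n` kept — `e_i` fixed, the
  transverse fluxes summed over in the thermal trace), which at `e_i = 0`, `i = 3`, spatial twist
  `n₁₂ = 1` and `N_f = 0` is LITERALLY the inline functional `Ex` of the route item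
  `Summit.QuantumFields.QCD.Theses.FemtoStepScaling.FemtoUniverseGapR`
  (`partialFluxProjectedSlabExpect_femto`).

## Contents and proved API

* Planes and twists of the anisotropic lattice (any `d`, any group `G`): `SlabPlane d = Fin d ⊕ Plane d`
  (`Sum.inl i` = the temporal plane `(0, i)`, `Sum.inr ⟨(i, j), _⟩` = the spatial plane `(i, j)`),
  `SlabTwist d G`, the seam and corner predicates `IsSlabSeam`, `IsSlabCorner`, the plaquette twist
  `slabPlaquetteTwist`, the twisted plaquette `slabTwistedPlaquette z U x P = ẑ_P(x)⁻¹ U_P(x)`, the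
  twisted action `slabTwistedMinusAction ρ z J_E J_M` (Borgs–Seiler's two couplings, the mirror of
  `FiniteTemperature.minusAction`) and weight `slabTwistedWeight = exp(slabTwistedMinusAction)`;
  PROVED: the trivial twist gives back `FiniteTemperature.minusAction/weight`
  (`slabTwistedMinusAction_one`, `slabTwistedWeight_one`); the factorisation
  `slabTwistedWeight = weight · exp(corner sum)` (`slabTwistedWeight_eq_weight_mul_exp`) and its
  `SU(N)` phase form (`trace_fundamentalRep_suCenter_inv_mul`, `slabTwistedWeight_slabTwistOfTensor`);
  at `J_E = J_M = 0` the weight is `1` (`slabTwistedWeight_zero`); continuity and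
  `0 < ∫ slabTwistedWeight` (`integral_slabTwistedWeight_pos`).
* Symmetries (request (3)): periodic gauge transformations `slabGaugeTransform g` — plaquettes are
  conjugated (`plaquette_slabGaugeTransform`), twisted plaquettes too (the twist is central,
  `slabTwistedPlaquette_slabGaugeTransform`), the twisted action and weight are INVARIANT
  (`slabTwistedMinusAction_slabGaugeTransform`, `slabTwistedWeight_slabGaugeTransform`), the
  product Haar measure is preserved (`measurePreserving_slabGaugeTransform`); the **spatial centre
  transformation** `spatialCentreMul i c` (multiply every direction-`i` link on the seam
  `x_i = −1` by a centre element `c` — the lattice form of the twisted/singular gauge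
  transformation `h_k`, `k = e_i`, whose characters are the electric fluxes; García
  Pérez–González-Arroyo–Okawa 2014 §5.1, van Baal 2001 §3.4) leaves EVERY plaquette invariant
  (`plaquette_spatialCentreMul`), hence every twisted weight (`slabTwistedWeight_spatialCentreMul`),
  preserves the Haar measure (`measurePreserving_spatialCentreMul`), reads through the anisotropic
  lift as the route's admissibility transformation on `ℤ⁴` (`slabLift_spatialCentreMul`), and a
  centre-COVARIANT function (`F(c·U) = ω F(U)`, `ω ≠ 1`: a Polyakov loop winding direction `i`)
  has zero integral against every twisted weight (`integral_mul_slabTwistedWeight_eq_zero_of_covariant`)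
  — the `ℤ₃³` electric-flux symmetry survives every twist (the pure-gauge content of the crux
  attack on `FemtoUniverseGap`).
* Centre phases: `centerPhase N = ZMod.stdAddChar` (`centerPhase_eq_stdAddChar`), `centerPhase_add`,
  `centerPhase_neg_mul`, `suCenter_zero/add/neg`, the twist of a tensor `slabTwistOfTensor N n`
  (`slabTwistOfTensor_zero`).
* Quarks (`d = 3`): `SlabFlavourTwist N_f`, `slabFlavourHop(Inv)`, the colour–flavour-twisted
  time-antiperiodic Wilson–Dirac operator `twistedSlabWilsonDirac F ρ b U mq r` and its reduction to
  `slabWilsonDirac` at `F = 1` (`twistedSlabWilsonDirac_one`); for `SU(3)`, `b = −1`, `r = 1`: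
  `twistedSlabDiracMatrix`, `twistedSlabBoltzmann` (`_one`: the untwisted ones of `QCDSlab`; `_zero`:
  `1` at `N_f = 0`).
* The functionals (`SU(3)`, requests (1), (2), (4)): `twistedSlabIntegral β T S n F mq X`
  (unnormalised), `twistedSlabPartition`, `twistedSlabExpect` — PROVED `twistedSlabExpect_zero_one :
  twistedSlabExpect β T S 0 1 mq = qcdSlabExpect β T S mq` (request (2)), `twistedSlabExpect_one`,
  the `N_f = 0` reduction to a reweighted Wilson integral (`twistedSlabIntegral_of_isEmpty`,
  request (1)) and the vanishing of centre-covariant gluonic observables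
  (`twistedSlabIntegral_eq_zero_of_covariant`); `fluxProjectedSlabIntegral/Expect`,
  `partialFluxProjectedSlabIntegral/Expect`; the route's data `femtoBaseTwist` (`n₁₂ = 1`),
  `femtoTwistWeight β k` (VERBATIM the route's `Tw k` with `β` for `afBeta 0 Λ (ℓ/S)`),
  `slabTwistedWeight_femto` and `partialFluxProjectedSlabExpect_femto` (the route's `Ex`); the
  generic connected Euclidean-time correlator `slabConnectedCorr E A B n` of a slab functional `E`
  (`= qcdSlabConnectedCorr` for `E = qcdSlabExpect`, `rfl`; `T`-periodic in `n`,
  `slabConnectedCorr_add_period`) and the twins `twistedSlabConnectedCorr`,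
  `fluxProjectedSlabConnectedCorr`, `partialFluxProjectedSlabConnectedCorr` (request (4)).

## Scope remarks

(i) The flavour twist `F` (and, in the projections, the family `Φ k`) is a parameter: the physics
wants `F_μ F_ν = z̄_{μν} F_ν F_μ` up to phases (twist eaters of the conjugate twist, which exist iff
the twist is orthogonal; `TwistedBoundaryConditions.lean` "Not here"); nothing here depends on it.
(ii) For `N_f ≥ 1` the centre transformation is NOT a symmetry of the quark action (the sibling
barrier `CenterSymmetryBreakingByQuarks`); the flux symmetry lemmas are about the gauge weight and
the `N_f = 0` functional. (iii) No positivity of `twistedSlabPartition` is claimed for `N_f ≥ 1`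
(signed determinant; junk `0` on division by zero, as in `QCDSlab`). (iv) The gauge
transformation `slabGaugeTransform` has the same body as `FiniteTemperature.gaugeAct` of
`Literature.Barriers.QuantumFields.FiniteTemperatureInfraredExplicitProofs`; it is re-declared here
(three lines) to keep that proof file and its imports out of the cone of the routes using this one.

## References

* G. 't Hooft, Nucl. Phys. B 153 (1979) 141–160, §2 (twist tensor `n_{μν}`, electric and magnetic
  fluxes, the `ℤ_N` Fourier transform defining the free energy of electric flux). Not held
  (acquisition request acq-02217); statements taken from the three open secondary sources below,
  which restate them. [tHooft1979Flux]
* P. van Baal, *QCD in a finite volume*, hep-ph/0008206, §3.1 (electric flux as the character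
  `Ψ([h_k h_1^ν]A) = e^{2πi e·k/N} e^{iθν} Ψ(A)` of the twisted gauge transformations), §3.4 (twist
  matrices, `Ω_k Ω_l = e^{2πi ε_{klj} m_j/N} Ω_l Ω_k`, the constant gauge transformations `h_k`
  multiplying `P_j` by `e^{2πi k_j/N}`, perturbative degeneracy of the `e₃` sectors). [Vanbaal2001]
* Ph. de Forcrand, L. von Smekal, Phys. Rev. D 66 (2002) 011504, hep-lat/0107018, §"Twisted
  Boundary Conditions and Electric Fluxes" (`n_{ij} ≡ ε_{ijk} m_k`, `n_{0i} ≡ k_i`;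
  `e^{−F(e⃗,m⃗,θ)/T} = N⁻³ Σ_{k⃗,ν} e^{−iω(k⃗,ν)} Z(k⃗,m⃗,ν)`, `ω = 2π e⃗·k⃗/N + θ(ν + k⃗·m⃗/N)`;
  `Z_e(e⃗) = Σ_k e^{−2πi e⃗·k⃗/N} Z_k(k⃗)/Σ_k Z_k(k⃗)`). [ForcrandSmekal2002]
* M. García Pérez, A. González-Arroyo, M. Okawa, Int. J. Mod. Phys. A 29 (2014) 1445001,
  arXiv:1406.5655, §5.1 (singular gauge transformations `Ω_[K](x + L_i) = e^{2πiK_i/N} Γ_i Ω Γ_i†`,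
  "symmetries of the action which … modify the Polyakov loops by an element of the center";
  electric-flux sectors `U(Ω_[K])|Ψ⟩ = e^{i2π e·K/N}|Ψ⟩`), §6 (lattice action with
  `z_{μν}(n) = 1` except on corner plaquettes). [GarciaperezGonzalezarroyoOkawa2014]
* C.-J. D. Lin, K. Ogawa, A. Ramos, JHEP 12 (2015) 103, §2.1 (fundamental fermions in the
  colour-twisted box, flavour rotating with the twist). [LinOgawaRamos2015]
* C. Borgs, E. Seiler, Commun. Math. Phys. 91 (1983) 329–380, §II.3 (II.20) (the lattice
  `ℤ_{L₀} × Λ_s`, couplings `J_E`, `J_M`). [BorgsSeiler1983]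
* I. Montvay, G. Münster, *Quantum Fields on a Lattice* (CUP 1994), §4.2.4 (4.112)–(4.114)
  (boundary sign factors), §5.1.1 (5.5). [MontvayMunster1994]
-/

noncomputable section

open MeasureTheory
open Literature.MathematicalPhysics.QuantumLattice Literature.Barriers.QuantumFields

namespace Literature.MathematicalPhysics.QuantumFieldTheory

local notation "𝔾" => Matrix.specialUnitaryGroup (Fin 3) ℂ

/-! ### Centre phases of `SU(N)` as an additive character of `ℤ/N` -/

section CenterPhase

variable (N : ℕ)

/-- The tree's centre phase `ω^k = e^{2πi k/N}` is Mathlib's standard additive character of `ℤ/N`. [folklore] -/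
theorem centerPhase_eq_stdAddChar [NeZero N] (k : ZMod N) :
    centerPhase N k = ZMod.stdAddChar k := by
  rw [ZMod.stdAddChar_apply, ZMod.toCircle_apply, centerPhase]
  congr 1
  push_cast
  ring

/-- `ω^0 = 1`. [folklore] -/
@[simp] theorem centerPhase_zero' : centerPhase N 0 = 1 := by
  simp [centerPhase]

/-- `ω^{a+b} = ω^a ω^b`. [folklore] -/
theorem centerPhase_add (a b : ZMod N) :
    centerPhase N (a + b) = centerPhase N a * centerPhase N b := by
  rcases Nat.eq_zero_or_pos N with hN | hN
  · subst hN; simp [centerPhase]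
  · haveI : NeZero N := ⟨hN.ne'⟩
    simp only [centerPhase_eq_stdAddChar, AddChar.map_add_eq_mul]

/-- `ω^{−a} ω^a = 1`. [folklore] -/
theorem centerPhase_neg_mul (a : ZMod N) : centerPhase N (-a) * centerPhase N a = 1 := by
  rw [← centerPhase_add, neg_add_cancel, centerPhase_zero']

/-- `ω^{−a} = (ω^a)⁻¹`. [folklore] -/
theorem centerPhase_neg (a : ZMod N) : centerPhase N (-a) = (centerPhase N a)⁻¹ :=
  eq_inv_of_mul_eq_one_left (centerPhase_neg_mul N a)

/-- `ω^{−a} = conj(ω^a)` (`|ω| = 1`). [folklore] -/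
theorem centerPhase_neg_eq_conj (a : ZMod N) :
    centerPhase N (-a) = starRingEnd ℂ (centerPhase N a) := by
  rw [centerPhase_neg, Complex.inv_def, Complex.normSq_eq_norm_sq, norm_centerPhase]
  simp

/-- The centre element of the zero twist is `1`. [folklore] -/
@[simp] theorem suCenter_zero : suCenter N 0 = 1 := by
  apply Subtype.ext; apply Subtype.ext
  simp [coe_suCenter]

/-- `suCenter` is additive-to-multiplicative: `ω^{a+b}·1 = (ω^a·1)(ω^b·1)`. [folklore] -/
theorem suCenter_add (a b : ZMod N) : suCenter N (a + b) = suCenter N a * suCenter N b := by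
  apply Subtype.ext; apply Subtype.ext
  simp [coe_suCenter, centerPhase_add, smul_smul, mul_comm]

/-- `suCenter N (−a)` is the inverse centre element. [folklore] -/
theorem suCenter_neg (a : ZMod N) : suCenter N (-a) = (suCenter N a)⁻¹ := by
  apply eq_inv_of_mul_eq_one_left
  rw [← suCenter_add, neg_add_cancel, suCenter_zero]

/-- In the fundamental representation `tr ρ(z_k⁻¹ g) = ω^{−k} tr ρ(g)` for the centre element
`z_k = ω^k·1`: the plaquette phase `e^{−2πi n_{μν}/N}` of the twisted Wilson action. [cite: GarciaperezGonzalezarroyoOkawa2014, §6] -/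
theorem trace_fundamentalRep_suCenter_inv_mul (k : ZMod N) (g : Matrix.specialUnitaryGroup (Fin N) ℂ) :
    (fundamentalRep (Fin N) (((suCenter N k)⁻¹ : Subgroup.center (Matrix.specialUnitaryGroup (Fin N) ℂ)) * g)).trace =
      centerPhase N (-k) * (fundamentalRep (Fin N) g).trace := by
  rw [← suCenter_neg, fundamentalRep_suCenter_mul, Matrix.trace_smul, smul_eq_mul]

end CenterPhase

/-! ### Coordinate planes, seams, corner plaquettes and twists of the anisotropic lattice -/

section Planes

/-- The six (for `d = 3`) coordinate planes of the anisotropic lattice `ℤ_T × (ℤ/S)^d`: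
`Sum.inl i` is the TEMPORAL plane `(0, i)` spanned by Euclidean time and the spatial direction `i`
(twist tensor entry `n_{0i} = k_i`, the temporal twist), `Sum.inr ⟨(i, j), _⟩`, `i < j`, the SPATIAL
plane `(i, j)` (entry `n_{ij} = ε_{ijk} m_k`, the magnetic flux). [cite: ForcrandSmekal2002, §"Twisted Boundary Conditions and Electric Fluxes"] -/
abbrev SlabPlane (d : ℕ) : Type := Fin d ⊕ Plane d

namespace SlabPlane

variable {d : ℕ}

/-- The first direction of a plane (Euclidean time for a temporal plane). [folklore] -/
def fst : SlabPlane d → FiniteTemperature.Dir d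
  | Sum.inl _ => none
  | Sum.inr p => some p.1.1

/-- The second direction of a plane (always spatial). [folklore] -/
def snd : SlabPlane d → FiniteTemperature.Dir d
  | Sum.inl i => some i
  | Sum.inr p => some p.1.2

/-- The first direction of a temporal plane is Euclidean time. [folklore] -/
@[simp] theorem fst_inl (i : Fin d) : fst (Sum.inl i : SlabPlane d) = none := rfl

/-- The second direction of the temporal plane `(0, i)` is `i`. [folklore] -/
@[simp] theorem snd_inl (i : Fin d) : snd (Sum.inl i : SlabPlane d) = some i := rfl

/-- The first direction of the spatial plane `(i, j)` is `i`. [folklore] -/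
@[simp] theorem fst_inr (p : Plane d) : fst (Sum.inr p : SlabPlane d) = some p.1.1 := rfl

/-- The second direction of the spatial plane `(i, j)` is `j`. [folklore] -/
@[simp] theorem snd_inr (p : Plane d) : snd (Sum.inr p : SlabPlane d) = some p.1.2 := rfl

end SlabPlane

variable {d T S : ℕ}

/-- The site `x` lies on the **seam** of direction `μ`: its `μ`-coordinate is the last one (`= −1`
in `ℤ/T`, resp. `ℤ/S`), i.e. the hop `x → x + μ̂` wraps around the torus. (For the time direction
this is the condition `x₀ + 1 = 0` of `seamSign`.) [cite: MontvayMunster1994, §4.2.4 (4.112)–(4.114)] -/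
def IsSlabSeam (x : FiniteTemperature.Site d T S) : FiniteTemperature.Dir d → Prop
  | none => x.1 = -1
  | some i => x.2 i = -1

/-- Seam membership is decidable. [folklore] -/
instance IsSlabSeam.instDecidable (x : FiniteTemperature.Site d T S) :
    ∀ μ, Decidable (IsSlabSeam x μ)
  | none => inferInstanceAs (Decidable (x.1 = -1))
  | some i => inferInstanceAs (Decidable (x.2 i = -1))

/-- The temporal seam: `t = −1`. [folklore] -/
@[simp] theorem isSlabSeam_none (x : FiniteTemperature.Site d T S) : IsSlabSeam x none ↔ x.1 = -1 :=
  Iff.rfl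

/-- The seam of the spatial direction `i`: `x_i = −1`. [folklore] -/
@[simp] theorem isSlabSeam_some (x : FiniteTemperature.Site d T S) (i : Fin d) :
    IsSlabSeam x (some i) ↔ x.2 i = -1 :=
  Iff.rfl

/-- The temporal seam condition of `QCDSlab.seamSign` (`x₀ + 1 = 0`) is `IsSlabSeam x none`. [folklore] -/
theorem isSlabSeam_none_iff_add_one (x : FiniteTemperature.Site d T S) :
    IsSlabSeam x none ↔ x.1 + 1 = 0 :=
  eq_neg_iff_add_eq_zero

/-- The plaquette based at `x` in the plane `P` is the **corner plaquette** of that plane (at its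
transverse position) iff `x` is on the seam of both directions of `P`: `x_μ = x_ν = −1`
(for a temporal plane: `t = −1` and `x_i = −1`). [cite: GarciaperezGonzalezarroyoOkawa2014, §6] -/
def IsSlabCorner (x : FiniteTemperature.Site d T S) (P : SlabPlane d) : Prop :=
  IsSlabSeam x P.fst ∧ IsSlabSeam x P.snd

/-- Being a corner plaquette is decidable. [folklore] -/
instance IsSlabCorner.instDecidable (x : FiniteTemperature.Site d T S) (P : SlabPlane d) :
    Decidable (IsSlabCorner x P) :=
  inferInstanceAs (Decidable (_ ∧ _))

/-- The corner plaquette of the temporal plane `(0, i)`: `t = −1` and `x_i = −1` (the literal form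
used by the route `FemtoStepScaling`). [cite: GarciaperezGonzalezarroyoOkawa2014, §6] -/
@[simp] theorem isSlabCorner_inl (x : FiniteTemperature.Site d T S) (i : Fin d) :
    IsSlabCorner x (Sum.inl i) ↔ x.1 = -1 ∧ x.2 i = -1 :=
  Iff.rfl

/-- The corner plaquette of the spatial plane `(i, j)`: `x_i = x_j = −1`. [cite: GarciaperezGonzalezarroyoOkawa2014, §6] -/
@[simp] theorem isSlabCorner_inr (x : FiniteTemperature.Site d T S) (p : Plane d) :
    IsSlabCorner x (Sum.inr p) ↔ x.2 p.1.1 = -1 ∧ x.2 p.1.2 = -1 :=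
  Iff.rfl

variable {G : Type*} [Group G] {N : ℕ}

/-- A **('t Hooft) twist of the anisotropic lattice**: a centre element for each of its coordinate
planes (for `SU(N)`: `z_P = e^{2πi n_P/N}·1`, `slabTwistOfTensor`). A group under pointwise
multiplication; `1` = periodic boundary conditions. [cite: tHooft1979Flux, §2 (2.2)–(2.5)] -/
abbrev SlabTwist (d : ℕ) (G : Type*) [Group G] : Type _ := SlabPlane d → Subgroup.center G

/-- The twist carried by the plaquette at `x` in the plane `P`: `z_P` on the corner plaquette,
`1` otherwise. [cite: GarciaperezGonzalezarroyoOkawa2014, §6] -/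
def slabPlaquetteTwist (z : SlabTwist d G) (x : FiniteTemperature.Site d T S) (P : SlabPlane d) : G :=
  if IsSlabCorner x P then (z P : G) else 1

/-- The plaquette twist is central. [folklore] -/
theorem slabPlaquetteTwist_mem_center (z : SlabTwist d G) (x : FiniteTemperature.Site d T S)
    (P : SlabPlane d) : slabPlaquetteTwist z x P ∈ Subgroup.center G := by
  unfold slabPlaquetteTwist
  split_ifs
  · exact (z P).2
  · exact Subgroup.one_mem _

/-- The trivial twist twists no plaquette. [folklore] -/
@[simp] theorem slabPlaquetteTwist_one (x : FiniteTemperature.Site d T S) (P : SlabPlane d) :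
    slabPlaquetteTwist (1 : SlabTwist d G) x P = 1 := by
  simp [slabPlaquetteTwist]

/-- The **twisted plaquette** `ẑ_P(x)⁻¹ U_P(x)` of the plane `P` at `x`: Borgs–Seiler's
`FiniteTemperature.plaquette U x μ ν` of the two directions of `P`, multiplied by the inverse twist
on the corner plaquette (the convention of `twistedHolonomy`). [cite: GarciaperezGonzalezarroyoOkawa2014, §6] -/
def slabTwistedPlaquette (z : SlabTwist d G) (U : FiniteTemperature.Config d T S G)
    (x : FiniteTemperature.Site d T S) (P : SlabPlane d) : G :=
  (slabPlaquetteTwist z x P)⁻¹ * FiniteTemperature.plaquette U x P.fst P.snd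

/-- With the trivial twist the twisted plaquette is the plaquette. [folklore] -/
@[simp] theorem slabTwistedPlaquette_one (U : FiniteTemperature.Config d T S G)
    (x : FiniteTemperature.Site d T S) (P : SlabPlane d) :
    slabTwistedPlaquette 1 U x P = FiniteTemperature.plaquette U x P.fst P.snd := by
  simp [slabTwistedPlaquette]

variable (ρ : G →* Matrix (Fin N) (Fin N) ℂ)

/-- **Minus the twisted finite-temperature Wilson action** with Borgs–Seiler's two couplings:
`J_E Σ_x Σ_i Re tr ρ(ẑ⁻¹U)_{x,(0,i)} + J_M Σ_x Σ_{i<j} Re tr ρ(ẑ⁻¹U)_{x,(i,j)}` — the mirror of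
`FiniteTemperature.minusAction ρ J_E J_M` with the twisted plaquettes: one twisted corner plaquette
per plane and per transverse position, all other plaquettes as in Wilson's action. [cite: GarciaperezGonzalezarroyoOkawa2014, §6] [cite: BorgsSeiler1983, §II.3 (II.20) (pp. 335–336)] -/
def slabTwistedMinusAction [NeZero T] [NeZero S] (z : SlabTwist d G) (JE JM : ℝ)
    (U : FiniteTemperature.Config d T S G) : ℝ :=
  JE * ∑ x : FiniteTemperature.Site d T S, ∑ i : Fin d,
      (ρ (slabTwistedPlaquette z U x (Sum.inl i))).trace.re +
    JM * ∑ x : FiniteTemperature.Site d T S, ∑ p : Plane d,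
      (ρ (slabTwistedPlaquette z U x (Sum.inr p))).trace.re

/-- The **twisted Boltzmann weight** `exp(−S_z) = exp(slabTwistedMinusAction)`. [cite: GarciaperezGonzalezarroyoOkawa2014, §6] -/
def slabTwistedWeight [NeZero T] [NeZero S] (z : SlabTwist d G) (JE JM : ℝ)
    (U : FiniteTemperature.Config d T S G) : ℝ :=
  Real.exp (slabTwistedMinusAction ρ z JE JM U)

/-- The trivial twist gives back Borgs–Seiler's action `FiniteTemperature.minusAction`. [folklore] -/
theorem slabTwistedMinusAction_one [NeZero T] [NeZero S] (JE JM : ℝ)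
    (U : FiniteTemperature.Config d T S G) :
    slabTwistedMinusAction ρ (1 : SlabTwist d G) JE JM U = FiniteTemperature.minusAction ρ JE JM U := by
  simp [slabTwistedMinusAction, FiniteTemperature.minusAction]

/-- The trivial twist gives back the Wilson weight `FiniteTemperature.weight`. [folklore] -/
@[simp] theorem slabTwistedWeight_one [NeZero T] [NeZero S] (JE JM : ℝ) :
    slabTwistedWeight ρ (1 : SlabTwist d G) JE JM =
      FiniteTemperature.weight (d := d) (L₀ := T) (L := S) ρ JE JM := by
  funext U
  rw [slabTwistedWeight, slabTwistedMinusAction_one, FiniteTemperature.weight]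

/-- The twisted weight is positive. [folklore] -/
theorem slabTwistedWeight_pos [NeZero T] [NeZero S] (z : SlabTwist d G) (JE JM : ℝ)
    (U : FiniteTemperature.Config d T S G) : 0 < slabTwistedWeight ρ z JE JM U :=
  Real.exp_pos _

/-- At zero couplings the twisted action vanishes. [folklore] -/
@[simp] theorem slabTwistedMinusAction_zero [NeZero T] [NeZero S] (z : SlabTwist d G)
    (U : FiniteTemperature.Config d T S G) : slabTwistedMinusAction ρ z 0 0 U = 0 := by
  simp [slabTwistedMinusAction]

/-- At zero couplings the twisted weight is `1` (whatever the twist). [folklore] -/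
@[simp] theorem slabTwistedWeight_zero [NeZero T] [NeZero S] (z : SlabTwist d G)
    (U : FiniteTemperature.Config d T S G) : slabTwistedWeight ρ z 0 0 U = 1 := by
  simp [slabTwistedWeight]

/-- **The twist as a reweighting of the periodic ensemble**: the exponent of the twisted weight
minus that of the Wilson weight is the sum over the CORNER plaquettes only of
`Re tr ρ(z_P⁻¹ U_P) − Re tr ρ(U_P)` (weighted by `J_E` on temporal, `J_M` on spatial planes). [folklore] -/
theorem slabTwistedMinusAction_sub_minusAction [NeZero T] [NeZero S] (z : SlabTwist d G)
    (JE JM : ℝ) (U : FiniteTemperature.Config d T S G) :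
    slabTwistedMinusAction ρ z JE JM U - FiniteTemperature.minusAction ρ JE JM U =
      JE * ∑ x : FiniteTemperature.Site d T S, ∑ i : Fin d,
          (if IsSlabCorner x (Sum.inl i) then
            ((ρ (((z (Sum.inl i))⁻¹ : Subgroup.center G) *
                FiniteTemperature.plaquette U x none (some i))).trace.re -
              (ρ (FiniteTemperature.plaquette U x none (some i))).trace.re)
          else 0) +
        JM * ∑ x : FiniteTemperature.Site d T S, ∑ p : Plane d,
          (if IsSlabCorner x (Sum.inr p) then
            ((ρ (((z (Sum.inr p))⁻¹ : Subgroup.center G) *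
                FiniteTemperature.plaquette U x (some p.1.1) (some p.1.2))).trace.re -
              (ρ (FiniteTemperature.plaquette U x (some p.1.1) (some p.1.2))).trace.re)
          else 0) := by
  have key : ∀ (x : FiniteTemperature.Site d T S) (P : SlabPlane d),
      (ρ (slabTwistedPlaquette z U x P)).trace.re -
          (ρ (FiniteTemperature.plaquette U x P.fst P.snd)).trace.re =
        if IsSlabCorner x P then
          ((ρ (((z P)⁻¹ : Subgroup.center G) * FiniteTemperature.plaquette U x P.fst P.snd)).trace.re -
            (ρ (FiniteTemperature.plaquette U x P.fst P.snd)).trace.re)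
        else 0 := by
    intro x P
    unfold slabTwistedPlaquette slabPlaquetteTwist
    split_ifs with h
    · simp
    · simp
  have h1 : ∑ x : FiniteTemperature.Site d T S, ∑ i : Fin d,
        (ρ (slabTwistedPlaquette z U x (Sum.inl i))).trace.re -
      ∑ x : FiniteTemperature.Site d T S, ∑ i : Fin d,
        (ρ (FiniteTemperature.plaquette U x none (some i))).trace.re =
      ∑ x : FiniteTemperature.Site d T S, ∑ i : Fin d,
          (if IsSlabCorner x (Sum.inl i) then
            ((ρ (((z (Sum.inl i))⁻¹ : Subgroup.center G) *
                FiniteTemperature.plaquette U x none (some i))).trace.re -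
              (ρ (FiniteTemperature.plaquette U x none (some i))).trace.re)
          else 0) := by
    rw [← Finset.sum_sub_distrib]
    refine Finset.sum_congr rfl fun x _ => ?_
    rw [← Finset.sum_sub_distrib]
    exact Finset.sum_congr rfl fun i _ => key x (Sum.inl i)
  have h2 : ∑ x : FiniteTemperature.Site d T S, ∑ p : Plane d,
        (ρ (slabTwistedPlaquette z U x (Sum.inr p))).trace.re -
      ∑ x : FiniteTemperature.Site d T S, ∑ p : Plane d,
        (ρ (FiniteTemperature.plaquette U x (some p.1.1) (some p.1.2))).trace.re =
      ∑ x : FiniteTemperature.Site d T S, ∑ p : Plane d,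
          (if IsSlabCorner x (Sum.inr p) then
            ((ρ (((z (Sum.inr p))⁻¹ : Subgroup.center G) *
                FiniteTemperature.plaquette U x (some p.1.1) (some p.1.2))).trace.re -
              (ρ (FiniteTemperature.plaquette U x (some p.1.1) (some p.1.2))).trace.re)
          else 0) := by
    rw [← Finset.sum_sub_distrib]
    refine Finset.sum_congr rfl fun x _ => ?_
    rw [← Finset.sum_sub_distrib]
    exact Finset.sum_congr rfl fun p _ => key x (Sum.inr p)
  rw [← h1, ← h2, slabTwistedMinusAction, FiniteTemperature.minusAction]
  ring

/-- The twisted weight is the Wilson weight times the exponential of the corner sum. [folklore] -/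
theorem slabTwistedWeight_eq_weight_mul_exp [NeZero T] [NeZero S] (z : SlabTwist d G)
    (JE JM : ℝ) (U : FiniteTemperature.Config d T S G) :
    slabTwistedWeight ρ z JE JM U = FiniteTemperature.weight ρ JE JM U *
      Real.exp (slabTwistedMinusAction ρ z JE JM U - FiniteTemperature.minusAction ρ JE JM U) := by
  rw [FiniteTemperature.weight, slabTwistedWeight, ← Real.exp_add, add_sub_cancel]

end Planes

/-! ### Symmetries: periodic gauge transformations and the spatial centre (flux) transformations -/

section Symmetry

variable {d T S N : ℕ} {G : Type*} [Group G]

/-- Elementary shifts of the anisotropic lattice commute. [folklore] -/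
theorem slabShift_comm (x : FiniteTemperature.Site d T S) (μ ν : FiniteTemperature.Dir d) :
    (x.shift μ).shift ν = (x.shift ν).shift μ := by
  rcases μ with _ | j <;> rcases ν with _ | k <;>
    simp only [FiniteTemperature.Site.shift, add_right_comm]

/-- A shift in a direction other than the spatial direction `i` does not change the `i`-th
spatial coordinate. [folklore] -/
theorem slabShift_snd_apply_of_ne (x : FiniteTemperature.Site d T S) {ν : FiniteTemperature.Dir d}
    {i : Fin d} (h : ν ≠ some i) : (x.shift ν).2 i = x.2 i := by
  cases ν with
  | none => rfl
  | some j =>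
      have hij : i ≠ j := fun e => h (by rw [e])
      simp [FiniteTemperature.Site.shift, Pi.single_eq_of_ne hij]

/-- **Periodic gauge transformations** of the anisotropic lattice by `g : sites → G`:
`U(x, μ) ↦ g(x) U(x, μ) g(x + μ̂)⁻¹` (same body as `FiniteTemperature.gaugeAct` of the infrared
proofs file, re-declared to keep the import cone small). [folklore] -/
def slabGaugeTransform (g : FiniteTemperature.Site d T S → G) (U : FiniteTemperature.Config d T S G) :
    FiniteTemperature.Config d T S G :=
  fun e => g e.1 * U e * (g (e.1.shift e.2))⁻¹

/-- Pointwise form of `slabGaugeTransform`. [folklore] -/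
@[simp] theorem slabGaugeTransform_apply (g : FiniteTemperature.Site d T S → G)
    (U : FiniteTemperature.Config d T S G) (x : FiniteTemperature.Site d T S) (μ : FiniteTemperature.Dir d) :
    slabGaugeTransform g U (x, μ) = g x * U (x, μ) * (g (x.shift μ))⁻¹ := rfl

/-- **Plaquettes are gauge covariant**: `U_P(U^g) = g(x) U_P(U) g(x)⁻¹`. [folklore] -/
theorem plaquette_slabGaugeTransform (g : FiniteTemperature.Site d T S → G)
    (U : FiniteTemperature.Config d T S G) (x : FiniteTemperature.Site d T S) (μ ν : FiniteTemperature.Dir d) :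
    FiniteTemperature.plaquette (slabGaugeTransform g U) x μ ν =
      g x * FiniteTemperature.plaquette U x μ ν * (g x)⁻¹ := by
  simp only [FiniteTemperature.plaquette, slabGaugeTransform_apply, mul_inv_rev, inv_inv,
    slabShift_comm x ν μ, mul_assoc, inv_mul_cancel_left]

/-- **Twisted plaquettes are gauge covariant** (the twist is central):
`ẑ_P⁻¹ U_P(U^g) = g(x) (ẑ_P⁻¹ U_P(U)) g(x)⁻¹`. [cite: Makeenko2023, §15.3 (after (15.65))] -/
theorem slabTwistedPlaquette_slabGaugeTransform (z : SlabTwist d G) (g : FiniteTemperature.Site d T S → G)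
    (U : FiniteTemperature.Config d T S G) (x : FiniteTemperature.Site d T S) (P : SlabPlane d) :
    slabTwistedPlaquette z (slabGaugeTransform g U) x P =
      g x * slabTwistedPlaquette z U x P * (g x)⁻¹ := by
  have hc : (slabPlaquetteTwist z x P)⁻¹ * g x = g x * (slabPlaquetteTwist z x P)⁻¹ :=
    (Subgroup.mem_center_iff.1 (Subgroup.inv_mem _ (slabPlaquetteTwist_mem_center z x P)) (g x)).symm
  rw [slabTwistedPlaquette, slabTwistedPlaquette, plaquette_slabGaugeTransform, ← mul_assoc,
    ← mul_assoc, hc]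
  simp only [mul_assoc]

variable (ρ : G →* Matrix (Fin N) (Fin N) ℂ)

/-- **Gauge invariance of the twisted action** under periodic gauge transformations (covariance
of the twisted plaquettes and cyclicity of the trace). [cite: Makeenko2023, §15.3] -/
theorem slabTwistedMinusAction_slabGaugeTransform [NeZero T] [NeZero S] (z : SlabTwist d G)
    (JE JM : ℝ) (g : FiniteTemperature.Site d T S → G) (U : FiniteTemperature.Config d T S G) :
    slabTwistedMinusAction ρ z JE JM (slabGaugeTransform g U) = slabTwistedMinusAction ρ z JE JM U := by
  have htr : ∀ a b : G, (ρ (a * b * a⁻¹)).trace = (ρ b).trace := fun a b => by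
    rw [map_mul, map_mul, Matrix.trace_mul_cycle, ← map_mul, inv_mul_cancel, map_one, one_mul]
  simp only [slabTwistedMinusAction, slabTwistedPlaquette_slabGaugeTransform, htr]

/-- **Gauge invariance of the twisted weight** under periodic gauge transformations. [cite: Makeenko2023, §15.3] -/
theorem slabTwistedWeight_slabGaugeTransform [NeZero T] [NeZero S] (z : SlabTwist d G)
    (JE JM : ℝ) (g : FiniteTemperature.Site d T S → G) (U : FiniteTemperature.Config d T S G) :
    slabTwistedWeight ρ z JE JM (slabGaugeTransform g U) = slabTwistedWeight ρ z JE JM U := by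
  rw [slabTwistedWeight, slabTwistedWeight, slabTwistedMinusAction_slabGaugeTransform]

/-- **The spatial centre transformation** of direction `i` by `c`: every link in the spatial
direction `i` that leaves the seam `x_i = −1` (i.e. crosses the boundary) is multiplied on the left
by `c`; all other links are unchanged. For central `c = e^{2πi k/N}·1` this is the lattice form of
the twisted ("singular") gauge transformation `h_k` of homotopy type `k ê_i` — a symmetry of every
twisted action which multiplies the Polyakov loops winding direction `i` by `c` and whose
characters are the electric fluxes `e_i`. [cite: GarciaperezGonzalezarroyoOkawa2014, §5.1] [cite: Vanbaal2001, §3.4] -/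
def spatialCentreMul (i : Fin d) (c : G) (U : FiniteTemperature.Config d T S G) :
    FiniteTemperature.Config d T S G :=
  fun e => if e.2 = some i ∧ e.1.2 i = -1 then c * U e else U e

/-- Pointwise form of `spatialCentreMul`. [folklore] -/
theorem spatialCentreMul_apply (i : Fin d) (c : G) (U : FiniteTemperature.Config d T S G)
    (x : FiniteTemperature.Site d T S) (μ : FiniteTemperature.Dir d) :
    spatialCentreMul i c U (x, μ) = if μ = some i ∧ x.2 i = -1 then c * U (x, μ) else U (x, μ) := rfl

/-- Links in directions other than `i` are unchanged. [folklore] -/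
theorem spatialCentreMul_apply_of_ne (i : Fin d) (c : G) (U : FiniteTemperature.Config d T S G)
    (x : FiniteTemperature.Site d T S) {μ : FiniteTemperature.Dir d} (h : μ ≠ some i) :
    spatialCentreMul i c U (x, μ) = U (x, μ) := by
  rw [spatialCentreMul_apply, if_neg (fun h' => h h'.1)]

/-- Direction-`i` links: multiplied by `c` exactly on the seam. [folklore] -/
theorem spatialCentreMul_apply_some (i : Fin d) (c : G) (U : FiniteTemperature.Config d T S G)
    (x : FiniteTemperature.Site d T S) :
    spatialCentreMul i c U (x, some i) = if x.2 i = -1 then c * U (x, some i) else U (x, some i) := by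
  rw [spatialCentreMul_apply]
  simp only [true_and]

/-- Composition: multiplying by `c'` then by `c` is multiplying by `c c'`. [folklore] -/
theorem spatialCentreMul_spatialCentreMul (i : Fin d) (c c' : G) (U : FiniteTemperature.Config d T S G) :
    spatialCentreMul i c (spatialCentreMul i c' U) = spatialCentreMul i (c * c') U := by
  funext e
  by_cases h : e.2 = some i ∧ e.1.2 i = -1 <;> simp [spatialCentreMul, h, mul_assoc]

/-- Multiplying by `1` does nothing. [folklore] -/
@[simp] theorem spatialCentreMul_one (i : Fin d) (U : FiniteTemperature.Config d T S G) :
    spatialCentreMul i (1 : G) U = U := by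
  funext e
  simp [spatialCentreMul]

/-- A central element conjugates away: `c a (c b)⁻¹ = a b⁻¹`. [folklore] -/
theorem central_mul_mul_inv_cancel {c : G} (hc : c ∈ Subgroup.center G) (a b : G) :
    c * a * (c * b)⁻¹ = a * b⁻¹ := by
  have hc' := Subgroup.mem_center_iff.1 hc
  rw [mul_inv_rev, ← hc' a, mul_assoc, ← mul_assoc c, ← hc' b⁻¹, mul_inv_cancel_right]

/-- **Every plaquette is invariant under the spatial centre transformation** (central `c`): a
plaquette contains zero or two direction-`i` links, and two such links sit at the same
`i`-coordinate, so both or neither are multiplied by `c`, which then cancels (`c U ⋯ (c U')⁻¹`). [cite: GarciaperezGonzalezarroyoOkawa2014, §5.1 ("symmetries of the action")] -/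
theorem plaquette_spatialCentreMul {c : G} (hc : c ∈ Subgroup.center G) (i : Fin d)
    (U : FiniteTemperature.Config d T S G) (x : FiniteTemperature.Site d T S) (μ ν : FiniteTemperature.Dir d) :
    FiniteTemperature.plaquette (spatialCentreMul i c U) x μ ν = FiniteTemperature.plaquette U x μ ν := by
  have hc' := Subgroup.mem_center_iff.1 hc
  by_cases hμ : μ = some i
  · subst hμ
    by_cases hν : ν = some i
    · subst hν
      simp only [FiniteTemperature.plaquette, mul_inv_cancel_right, mul_inv_cancel]
    · simp only [FiniteTemperature.plaquette, spatialCentreMul_apply_some,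
        spatialCentreMul_apply_of_ne i c U _ hν, slabShift_snd_apply_of_ne x hν]
      by_cases hx : x.2 i = -1
      · simp only [hx, if_true]
        rw [mul_assoc c, central_mul_mul_inv_cancel hc]
      · simp only [hx, if_false]
  · by_cases hν : ν = some i
    · subst hν
      simp only [FiniteTemperature.plaquette, spatialCentreMul_apply_some,
        spatialCentreMul_apply_of_ne i c U _ hμ, slabShift_snd_apply_of_ne x hμ]
      by_cases hx : x.2 i = -1
      · simp only [hx, if_true]
        rw [← mul_assoc (U (x, μ)) c, hc' (U (x, μ)), mul_assoc c, mul_assoc c,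
          central_mul_mul_inv_cancel hc]
      · simp only [hx, if_false]
    · simp only [FiniteTemperature.plaquette, spatialCentreMul_apply_of_ne i c U _ hμ,
        spatialCentreMul_apply_of_ne i c U _ hν]

/-- Hence every twisted plaquette is invariant. [folklore] -/
theorem slabTwistedPlaquette_spatialCentreMul {c : G} (hc : c ∈ Subgroup.center G) (i : Fin d)
    (z : SlabTwist d G) (U : FiniteTemperature.Config d T S G) (x : FiniteTemperature.Site d T S)
    (P : SlabPlane d) :
    slabTwistedPlaquette z (spatialCentreMul i c U) x P = slabTwistedPlaquette z U x P := by
  rw [slabTwistedPlaquette, slabTwistedPlaquette, plaquette_spatialCentreMul hc]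

/-- **Every twisted action is invariant under the spatial centre transformations**
(`ℤ_N^d` electric-flux symmetry for `SU(N)`). [cite: GarciaperezGonzalezarroyoOkawa2014, §5.1] -/
theorem slabTwistedMinusAction_spatialCentreMul [NeZero T] [NeZero S] {c : G}
    (hc : c ∈ Subgroup.center G) (i : Fin d) (z : SlabTwist d G) (JE JM : ℝ)
    (U : FiniteTemperature.Config d T S G) :
    slabTwistedMinusAction ρ z JE JM (spatialCentreMul i c U) = slabTwistedMinusAction ρ z JE JM U := by
  simp only [slabTwistedMinusAction, slabTwistedPlaquette_spatialCentreMul hc]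

/-- Every twisted weight is invariant under the spatial centre transformations. [cite: GarciaperezGonzalezarroyoOkawa2014, §5.1] -/
theorem slabTwistedWeight_spatialCentreMul [NeZero T] [NeZero S] {c : G}
    (hc : c ∈ Subgroup.center G) (i : Fin d) (z : SlabTwist d G) (JE JM : ℝ)
    (U : FiniteTemperature.Config d T S G) :
    slabTwistedWeight ρ z JE JM (spatialCentreMul i c U) = slabTwistedWeight ρ z JE JM U := by
  rw [slabTwistedWeight, slabTwistedWeight, slabTwistedMinusAction_spatialCentreMul ρ hc]

/-- **The centre transformation read through the anisotropic lift** (`d = 3`): on `ℤ⁴` it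
multiplies by `c` exactly the links in direction `i + 1` whose base point has
`x_{i+1} ≡ −1 (mod S)` — for `i = 2` the transformation in the admissibility clause of the route
item `FemtoUniverseGapR` (`e.2 = 3 ∧ S ∣ e.1 3 + 1`). [folklore] -/
theorem slabLift_spatialCentreMul (T S : ℕ) (i : Fin 3) (c : G) (U : FiniteTemperature.Config 3 T S G) :
    slabLift T S (spatialCentreMul i c U) =
      fun e => if e.2 = i.succ ∧ (S : ℤ) ∣ (e.1 i.succ + 1) then c * slabLift T S U e else slabLift T S U e := by
  funext e
  rw [slabLift_apply, slabLift_apply, spatialCentreMul_apply]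
  have h1 : (slabDir e.2 = some i) ↔ e.2 = i.succ := by
    constructor
    · intro h
      have := congrArg slabAxis h
      rwa [slabAxis_slabDir] at this
    · rintro h; rw [h]; rfl
  have h2 : ((slabSite T S e.1).2 i = -1) ↔ (S : ℤ) ∣ (e.1 i.succ + 1) := by
    change (((e.1 i.succ : ℤ) : ZMod S) = -1) ↔ _
    rw [eq_neg_iff_add_eq_zero, ← Int.cast_one, ← Int.cast_add, ZMod.intCast_zmod_eq_zero_iff_dvd]
  simp only [h1, h2]

/-- The case `i = 2` in the literal form of the route's admissibility clause: the direction-`3`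
links of `ℤ⁴` with `S ∣ x₃ + 1` are multiplied by `c`. [folklore] -/
theorem slabLift_spatialCentreMul_two (T S : ℕ) (c : G) (U : FiniteTemperature.Config 3 T S G) :
    slabLift T S (spatialCentreMul 2 c U) =
      fun e => if e.2 = 3 ∧ (S : ℤ) ∣ (e.1 3 + 1) then c * slabLift T S U e else slabLift T S U e :=
  slabLift_spatialCentreMul T S 2 c U

variable [TopologicalSpace G] [IsTopologicalGroup G] [CompactSpace G] [MeasurableSpace G]
  [BorelSpace G]

/-- **Gauge transformations preserve the product Haar measure** of the anisotropic lattice (link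
by link a two-sided translation). [folklore] -/
theorem measurePreserving_slabGaugeTransform [NeZero T] [NeZero S] (g : FiniteTemperature.Site d T S → G) :
    MeasurePreserving (slabGaugeTransform g : FiniteTemperature.Config d T S G → FiniteTemperature.Config d T S G)
      (FiniteTemperature.haar d T S G) (FiniteTemperature.haar d T S G) :=
  measurePreserving_pi
    (f := fun (e : FiniteTemperature.Site d T S × FiniteTemperature.Dir d) (x : G) =>
      g e.1 * x * (g (e.1.shift e.2))⁻¹)
    (fun _ => haarProbability G) (fun _ => haarProbability G)
    fun e => WilsonGauge.measurePreserving_mul_mul (g e.1) (g (e.1.shift e.2))⁻¹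

/-- **The spatial centre transformations preserve the product Haar measure** (link by link the
identity or a left translation). [folklore] -/
theorem measurePreserving_spatialCentreMul [NeZero T] [NeZero S] (i : Fin d) (c : G) :
    MeasurePreserving (spatialCentreMul i c : FiniteTemperature.Config d T S G → FiniteTemperature.Config d T S G)
      (FiniteTemperature.haar d T S G) (FiniteTemperature.haar d T S G) := by
  refine measurePreserving_pi
    (f := fun (e : FiniteTemperature.Site d T S × FiniteTemperature.Dir d) (x : G) =>
      if e.2 = some i ∧ e.1.2 i = -1 then c * x else x)
    (fun _ => haarProbability G) (fun _ => haarProbability G) fun e => ?_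
  by_cases h : e.2 = some i ∧ e.1.2 i = -1
  · simp only [h, and_self, if_true]
    exact measurePreserving_mul_left (haarProbability G) c
  · simp only [h, if_false]
    exact MeasurePreserving.id _

/-- The spatial centre transformation by `c` as a measurable equivalence (inverse: by `c⁻¹`). [folklore] -/
def spatialCentreMulEquiv [NeZero T] [NeZero S] (i : Fin d) (c : G) :
    FiniteTemperature.Config d T S G ≃ᵐ FiniteTemperature.Config d T S G where
  toFun := spatialCentreMul i c
  invFun := spatialCentreMul i c⁻¹
  left_inv U := by rw [spatialCentreMul_spatialCentreMul, inv_mul_cancel, spatialCentreMul_one]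
  right_inv U := by rw [spatialCentreMul_spatialCentreMul, mul_inv_cancel, spatialCentreMul_one]
  measurable_toFun := (measurePreserving_spatialCentreMul i c).measurable
  measurable_invFun := (measurePreserving_spatialCentreMul i c⁻¹).measurable

/-- Change of variables: integrals over the Haar measure are invariant under the spatial centre
transformation. [folklore] -/
theorem integral_comp_spatialCentreMul [NeZero T] [NeZero S] {E : Type*} [NormedAddCommGroup E]
    [NormedSpace ℝ E] (i : Fin d) (c : G) (f : FiniteTemperature.Config d T S G → E) :
    ∫ U, f (spatialCentreMul i c U) ∂(FiniteTemperature.haar d T S G) =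
      ∫ U, f U ∂(FiniteTemperature.haar d T S G) :=
  (measurePreserving_spatialCentreMul i c).integral_comp
    (spatialCentreMulEquiv (T := T) (S := S) i c).measurableEmbedding f

/-- **Centre-covariant functions integrate to zero against every twisted weight** (the
electric-flux selection rule): if `F(c · U) = ω F(U)` with `ω ≠ 1` for a central `c` — e.g. the
trace of a Polyakov loop winding once around the spatial direction `i`, `ω = e^{2πi k/N}` — then
`∫ F e^{−S_z} ∏dU = 0` for EVERY twist `z`, since the weight and the Haar measure are invariant. So
the flux symmetry survives the 't Hooft twist, and flux-carrying observables see the degenerate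
`e_i`-sectors (the content of the crux attack on the unprojected femto-universe statement). [cite: GarciaperezGonzalezarroyoOkawa2014, §5.1] [cite: Vanbaal2001, §3.4] -/
theorem integral_mul_slabTwistedWeight_eq_zero_of_covariant [NeZero T] [NeZero S] {c : G}
    (hc : c ∈ Subgroup.center G) (i : Fin d) (z : SlabTwist d G) (JE JM : ℝ)
    {F : FiniteTemperature.Config d T S G → ℂ} {ω : ℂ} (hω : ω ≠ 1)
    (hF : ∀ U, F (spatialCentreMul i c U) = ω * F U) :
    ∫ U, F U * (slabTwistedWeight ρ z JE JM U : ℂ) ∂(FiniteTemperature.haar d T S G) = 0 := by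
  set I := ∫ U, F U * (slabTwistedWeight ρ z JE JM U : ℂ) ∂(FiniteTemperature.haar d T S G) with hI
  have h : I = ω * I := by
    calc I = ∫ U, F (spatialCentreMul i c U) *
          (slabTwistedWeight ρ z JE JM (spatialCentreMul i c U) : ℂ) ∂(FiniteTemperature.haar d T S G) :=
          (integral_comp_spatialCentreMul i c _).symm
      _ = ∫ U, ω * (F U * (slabTwistedWeight ρ z JE JM U : ℂ)) ∂(FiniteTemperature.haar d T S G) := by
          refine integral_congr_ae (Filter.Eventually.of_forall fun U => ?_)
          simp only [hF U, slabTwistedWeight_spatialCentreMul ρ hc, mul_assoc]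
      _ = ω * I := integral_const_mul ω _
  have h' : (1 - ω) * I = 0 := by rw [sub_mul, one_mul, ← h, sub_self]
  rcases mul_eq_zero.1 h' with h1 | h1
  · exact absurd (sub_eq_zero.1 h1).symm hω
  · exact h1

omit [CompactSpace G] [MeasurableSpace G] [BorelSpace G] in
/-- The twisted action is continuous for a continuous representation. [folklore] -/
theorem continuous_slabTwistedMinusAction [NeZero T] [NeZero S] (hρ : Continuous ρ) (z : SlabTwist d G)
    (JE JM : ℝ) : Continuous fun U : FiniteTemperature.Config d T S G => slabTwistedMinusAction ρ z JE JM U := by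
  unfold slabTwistedMinusAction slabTwistedPlaquette
  have htr : ∀ (x : FiniteTemperature.Site d T S) (P : SlabPlane d),
      Continuous fun U : FiniteTemperature.Config d T S G =>
        (ρ ((slabPlaquetteTwist z x P)⁻¹ * FiniteTemperature.plaquette U x P.fst P.snd)).trace.re :=
    fun x P => Complex.continuous_re.comp (Continuous.matrix_trace (hρ.comp
      (continuous_const.mul (FiniteTemperature.continuous_plaquette x _ _))))
  refine (continuous_const.mul ?_).add (continuous_const.mul ?_)
  · exact continuous_finsetSum _ fun x _ => continuous_finsetSum _ fun i _ => htr x _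
  · exact continuous_finsetSum _ fun x _ => continuous_finsetSum _ fun p _ => htr x _

omit [CompactSpace G] [MeasurableSpace G] [BorelSpace G] in
/-- The twisted weight is continuous for a continuous representation. [folklore] -/
theorem continuous_slabTwistedWeight [NeZero T] [NeZero S] (hρ : Continuous ρ) (z : SlabTwist d G)
    (JE JM : ℝ) : Continuous fun U : FiniteTemperature.Config d T S G => slabTwistedWeight ρ z JE JM U :=
  Real.continuous_exp.comp (continuous_slabTwistedMinusAction ρ hρ z JE JM)

variable [SecondCountableTopology G]

/-- The twisted weight is integrable. [folklore] -/
theorem integrable_slabTwistedWeight [NeZero T] [NeZero S] (hρ : Continuous ρ) (z : SlabTwist d G)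
    (JE JM : ℝ) : Integrable (slabTwistedWeight ρ z JE JM) (FiniteTemperature.haar d T S G) :=
  FiniteTemperature.integrable_of_continuous (continuous_slabTwistedWeight ρ hρ z JE JM)

/-- **`Z_z > 0`**: the twisted pure-gauge partition function `∫ e^{−S_z} ∏dU` is positive. [folklore] -/
theorem integral_slabTwistedWeight_pos [NeZero T] [NeZero S] (hρ : Continuous ρ) (z : SlabTwist d G)
    (JE JM : ℝ) : 0 < ∫ U, slabTwistedWeight ρ z JE JM U ∂(FiniteTemperature.haar d T S G) := by
  unfold slabTwistedWeight
  exact integral_exp_pos (integrable_slabTwistedWeight ρ hρ z JE JM)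

end Symmetry

/-! ### `SU(N)`: the twist of a twist tensor on the anisotropic lattice -/

section SUN

variable {d T S : ℕ} (N : ℕ)

/-- The **twist of a twist tensor** on the anisotropic lattice: `z_P = e^{2πi n_P/N}·1 ∈ Z(SU(N))`
for `n : SlabPlane d → ℤ/N` (`n (inl i) = n_{0i} = k_i`, `n (inr (i,j)) = n_{ij}`). [cite: tHooft1979Flux, §2 (2.5)] [cite: ForcrandSmekal2002, §"Twisted Boundary Conditions and Electric Fluxes"] -/
def slabTwistOfTensor (n : SlabPlane d → ZMod N) : SlabTwist d (Matrix.specialUnitaryGroup (Fin N) ℂ) :=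
  fun P => suCenter N (n P)

/-- The zero tensor is the trivial twist. [folklore] -/
@[simp] theorem slabTwistOfTensor_zero : slabTwistOfTensor (d := d) N 0 = 1 := by
  funext P
  simp [slabTwistOfTensor]

/-- Splitting a tensor into temporal and spatial parts: `Sum.elim k m` has temporal twist `k` and
spatial twist `m`. [folklore] -/
@[simp] theorem slabTwistOfTensor_elim_inl (k : Fin d → ZMod N) (m : Plane d → ZMod N) (i : Fin d) :
    slabTwistOfTensor N (Sum.elim k m) (Sum.inl i) = suCenter N (k i) := rfl

/-- The spatial part of `Sum.elim k m` is `m`. [folklore] -/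
@[simp] theorem slabTwistOfTensor_elim_inr (k : Fin d → ZMod N) (m : Plane d → ZMod N) (p : Plane d) :
    slabTwistOfTensor N (Sum.elim k m) (Sum.inr p) = suCenter N (m p) := rfl

/-- **The `SU(N)` twist reweighting factor, explicitly**: in the fundamental representation the
twisted weight of the tensor `n` is the Wilson weight times
`exp(J_E Σ_x Σ_i [corner] (Re(ω^{−n_{0i}} tr U_P) − Re tr U_P) + J_M Σ_x Σ_{i<j} [corner] (Re(ω^{−n_{ij}} tr U_P) − Re tr U_P))`. [cite: GarciaperezGonzalezarroyoOkawa2014, §6] -/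
theorem slabTwistedWeight_slabTwistOfTensor [NeZero T] [NeZero S] (n : SlabPlane d → ZMod N) (JE JM : ℝ)
    (U : FiniteTemperature.Config d T S (Matrix.specialUnitaryGroup (Fin N) ℂ)) :
    slabTwistedWeight (fundamentalRep (Fin N)) (slabTwistOfTensor N n) JE JM U =
      FiniteTemperature.weight (fundamentalRep (Fin N)) JE JM U *
        Real.exp (JE * ∑ x : FiniteTemperature.Site d T S, ∑ i : Fin d,
            (if IsSlabCorner x (Sum.inl i) then
              ((centerPhase N (-(n (Sum.inl i))) *
                  (fundamentalRep (Fin N) (FiniteTemperature.plaquette U x none (some i))).trace).re -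
                (fundamentalRep (Fin N) (FiniteTemperature.plaquette U x none (some i))).trace.re)
            else 0) +
          JM * ∑ x : FiniteTemperature.Site d T S, ∑ p : Plane d,
            (if IsSlabCorner x (Sum.inr p) then
              ((centerPhase N (-(n (Sum.inr p))) *
                  (fundamentalRep (Fin N) (FiniteTemperature.plaquette U x (some p.1.1) (some p.1.2))).trace).re -
                (fundamentalRep (Fin N) (FiniteTemperature.plaquette U x (some p.1.1) (some p.1.2))).trace.re)
            else 0)) := by
  rw [slabTwistedWeight_eq_weight_mul_exp, slabTwistedMinusAction_sub_minusAction]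
  simp only [slabTwistOfTensor, trace_fundamentalRep_suCenter_inv_mul]

end SUN

/-! ### Colour–flavour-twisted time-antiperiodic Wilson quarks on `ℤ_T × (ℤ/S)³` -/

section Dirac

variable {T S N Nf : ℕ} {G : Type*} [Group G]

variable (Nf) in
/-- A **flavour twist**: one `N_f × N_f` flavour matrix `F_μ` per direction of the anisotropic
lattice (for fundamental quarks on the twisted torus: `F_ν = e^{iθ_ν} Ω̄_ν ⊗ 1`, a twist eater of
the conjugate twist; `F ≡ 1`: no flavour twist). [cite: LinOgawaRamos2015, §2.1] -/
abbrev SlabFlavourTwist : Type := FiniteTemperature.Dir 3 → Matrix (Fin Nf) (Fin Nf) ℂ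

variable (F : SlabFlavourTwist Nf)

/-- The flavour matrix on a FORWARD hop from `x` across direction `μ`: `F_μ` if the hop crosses
the seam (`x_μ = −1`), `1` otherwise. [cite: LinOgawaRamos2015, §2.1 (fermion boundary condition)] -/
def slabFlavourHop (x : FiniteTemperature.Site 3 T S) (μ : FiniteTemperature.Dir 3) :
    Matrix (Fin Nf) (Fin Nf) ℂ :=
  if IsSlabSeam x μ then F μ else 1

/-- The flavour matrix on a BACKWARD hop into `x + μ̂` across direction `μ`: `F_μ⁻¹` if the hop
crosses the seam, `1` otherwise. [cite: LinOgawaRamos2015, §2.1] -/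
def slabFlavourHopInv (x : FiniteTemperature.Site 3 T S) (μ : FiniteTemperature.Dir 3) :
    Matrix (Fin Nf) (Fin Nf) ℂ :=
  if IsSlabSeam x μ then (F μ)⁻¹ else 1

/-- No flavour twist: the forward hop matrix is `1`. [folklore] -/
@[simp] theorem slabFlavourHop_one (x : FiniteTemperature.Site 3 T S) (μ : FiniteTemperature.Dir 3) :
    slabFlavourHop (1 : SlabFlavourTwist Nf) x μ = 1 := by
  simp [slabFlavourHop]

/-- No flavour twist: the backward hop matrix is `1`. [folklore] -/
@[simp] theorem slabFlavourHopInv_one (x : FiniteTemperature.Site 3 T S) (μ : FiniteTemperature.Dir 3) :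
    slabFlavourHopInv (1 : SlabFlavourTwist Nf) x μ = 1 := by
  simp [slabFlavourHopInv]

variable (ρ : G →* Matrix (Fin N) (Fin N) ℂ)

/-- **The colour–flavour-twisted Wilson–Dirac operator on `ℤ_T × (ℤ/S)³`** (index flavour ×
(site × colour × spin), the order of `SlabQuarkVar`): flavour by flavour the tree's
`slabWilsonDirac ρ b U m_f r` — gauge-covariant Wilson hops with the `γ`-matrices `slabGamma`, the
temporal boundary sign `b` of Montvay–Münster (4.112)–(4.114) (`b = −1`: time-antiperiodic), bare
masses `m_f` on the diagonal — except that a hop crossing the seam `x_μ = −1` of ANY direction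
rotates the flavour index by `F_μ` (forward) / `F_μ⁻¹` (backward): the slab transplant of
`flavourTwistedWilsonDirac`. [cite: LinOgawaRamos2015, §2.1] [cite: MontvayMunster1994, §4.2.2 (4.85)–(4.89), §4.2.4 (4.112)–(4.114), §5.1.1 (5.5)] -/
def twistedSlabWilsonDirac (b : ℤˣ) (U : FiniteTemperature.Config 3 T S G) (mq : Fin Nf → ℝ) (r : ℝ) :
    Matrix (Fin Nf × (FiniteTemperature.Site 3 T S × Fin N × Fin 4))
      (Fin Nf × (FiniteTemperature.Site 3 T S × Fin N × Fin 4)) ℂ :=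
  Matrix.of fun p q =>
    (if p = q then ((mq p.1 + 4 * r : ℝ) : ℂ) else 0) -
      (1 / 2 : ℂ) * ∑ μ : FiniteTemperature.Dir 3,
        ((if q.2.1 = p.2.1.shift μ then
            slabFlavourHop F p.2.1 μ p.1 q.1 *
              (seamSign b p.2.1 μ *
                (((r : ℂ) • (1 : Matrix (Fin 4) (Fin 4) ℂ) - slabGamma μ) p.2.2.2 q.2.2.2 *
                  ρ (U (p.2.1, μ)) p.2.2.1 q.2.2.1)) else 0) +
          (if p.2.1 = q.2.1.shift μ then
            slabFlavourHopInv F q.2.1 μ p.1 q.1 *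
              (seamSign b q.2.1 μ *
                (((r : ℂ) • (1 : Matrix (Fin 4) (Fin 4) ℂ) + slabGamma μ) p.2.2.2 q.2.2.2 *
                  ρ (U (q.2.1, μ))⁻¹ p.2.2.1 q.2.2.1)) else 0))

/-- **No flavour twist gives the flavour-diagonal slab operator**: with `F ≡ 1` the operator is
`⊕_f slabWilsonDirac ρ b U m_f r` (the matrix inside `QCDSlab.slabDiracMatrix`). [folklore] -/
theorem twistedSlabWilsonDirac_one (b : ℤˣ) (U : FiniteTemperature.Config 3 T S G) (mq : Fin Nf → ℝ)
    (r : ℝ) (p q : Fin Nf × (FiniteTemperature.Site 3 T S × Fin N × Fin 4)) :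
    twistedSlabWilsonDirac (1 : SlabFlavourTwist Nf) ρ b U mq r p q =
      if p.1 = q.1 then slabWilsonDirac ρ b U (mq p.1) r p.2 q.2 else 0 := by
  unfold twistedSlabWilsonDirac slabWilsonDirac
  simp only [Matrix.of_apply, slabFlavourHop_one, slabFlavourHopInv_one, Matrix.one_apply, ite_mul,
    one_mul, zero_mul]
  by_cases h : p.1 = q.1
  · simp only [h, if_true]
    congr 1
    by_cases hpq : p = q
    · subst hpq; simp
    · have : p.2 ≠ q.2 := fun h2 => hpq (Prod.ext h h2)
      simp [hpq, this]
  · have hpq : p ≠ q := fun h' => h (congrArg Prod.fst h')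
    simp [h, hpq]

end Dirac

/-! ### The `SU(3)` Grassmann data and the twisted thermal functionals -/

section Functional

variable {Nf T S : ℕ} [NeZero T] [NeZero S]

/-- The `N_f`-flavour colour–flavour-twisted, time-antiperiodic (`b = −1`), `r = 1` Wilson–Dirac
matrix in the `SU(3)` background `U`, on the enumerated quark variables of `QCDSlab`. [cite: MontvayMunster1994, §5.1.1 (5.5) and §4.2.4 (4.112)–(4.114)] [cite: LinOgawaRamos2015, §2.1] -/
def twistedSlabDiracMatrix (F : SlabFlavourTwist Nf) (U : FiniteTemperature.Config 3 T S 𝔾)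
    (mq : Fin Nf → ℝ) : Matrix (SlabFermiIdx Nf T S) (SlabFermiIdx Nf T S) ℂ :=
  Matrix.reindex slabQuarkEquiv slabQuarkEquiv
    (twistedSlabWilsonDirac F (fundamentalRep (Fin 3)) (-1) U mq 1)

/-- No flavour twist: the Dirac matrix of `QCDSlab`. [folklore] -/
@[simp] theorem twistedSlabDiracMatrix_one (U : FiniteTemperature.Config 3 T S 𝔾) (mq : Fin Nf → ℝ) :
    twistedSlabDiracMatrix (1 : SlabFlavourTwist Nf) U mq = slabDiracMatrix U mq := by
  unfold twistedSlabDiracMatrix slabDiracMatrix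
  congr 1
  ext v w
  rw [twistedSlabWilsonDirac_one, Matrix.of_apply]

/-- The fermionic Boltzmann factor `exp(−ψ̄ D_F(U) ψ)` of the twisted quarks. [cite: MontvayMunster1994, §4.1 (4.14)–(4.17)] -/
def twistedSlabBoltzmann (F : SlabFlavourTwist Nf) (U : FiniteTemperature.Config 3 T S 𝔾)
    (mq : Fin Nf → ℝ) : SlabFermiAlg Nf T S :=
  grassmannExp (quadratic ℂ (-twistedSlabDiracMatrix F U mq))

/-- No flavour twist: the Boltzmann factor of `QCDSlab`. [folklore] -/
@[simp] theorem twistedSlabBoltzmann_one (U : FiniteTemperature.Config 3 T S 𝔾) (mq : Fin Nf → ℝ) :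
    twistedSlabBoltzmann (1 : SlabFlavourTwist Nf) U mq = slabFermiBoltzmann U mq := by
  rw [twistedSlabBoltzmann, twistedSlabDiracMatrix_one, slabFermiBoltzmann]

/-- With no flavours the Boltzmann factor is `1`. [folklore] -/
@[simp] theorem twistedSlabBoltzmann_zero (F : SlabFlavourTwist 0) (U : FiniteTemperature.Config 3 T S 𝔾)
    (mq : Fin 0 → ℝ) : twistedSlabBoltzmann F U mq = 1 := by
  simp [twistedSlabBoltzmann, quadratic, grassmannExp, IsNilpotent.exp]

/-- **The unnormalised twisted functional** `I_{n,F}(X) = ∫∏dU e^{−S_n(U)} ∫dψ̄dψ X(U) e^{−ψ̄D_F(U)ψ}`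
of lattice QCD on `ℤ_T × (ℤ/S)³` with 't Hooft twist tensor `n` on all six planes (twisted
`SU(3)` weight `slabTwistedWeight ρ (slabTwistOfTensor 3 n) β β`, one coupling `β` in the tree's
normalisation) and flavour twist `F` (`= Z_n ⟨X⟩_n`; the objects the electric-flux projection
averages). [cite: GarciaperezGonzalezarroyoOkawa2014, §6] [cite: ForcrandSmekal2002, §"Twisted Boundary Conditions and Electric Fluxes"] -/
def twistedSlabIntegral (β : ℝ) (T S : ℕ) [NeZero T] [NeZero S] (n : SlabPlane 3 → ZMod 3)
    (F : SlabFlavourTwist Nf) (mq : Fin Nf → ℝ)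
    (X : FiniteTemperature.Config 3 T S 𝔾 → SlabFermiAlg Nf T S) : ℂ :=
  ∫ U, slabFermiIntegral (X U * twistedSlabBoltzmann F U mq) *
      ((slabTwistedWeight (fundamentalRep (Fin 3)) (slabTwistOfTensor 3 n) β β U : ℝ) : ℂ)
    ∂(FiniteTemperature.haar 3 T S 𝔾)

/-- **The twisted partition function** `Z_{n,F} = I_{n,F}(1)` ('t Hooft's `W{n}` on the lattice,
with quarks; signed determinant, no positivity claimed for `N_f ≥ 1`). [cite: tHooft1979Flux, §2 (2.6)] [cite: ForcrandSmekal2002, §"Twisted Boundary Conditions and Electric Fluxes"] -/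
def twistedSlabPartition (β : ℝ) (T S : ℕ) [NeZero T] [NeZero S] (n : SlabPlane 3 → ZMod 3)
    (F : SlabFlavourTwist Nf) (mq : Fin Nf → ℝ) : ℂ :=
  twistedSlabIntegral β T S n F mq fun _ => 1

/-- **Lattice QCD expectation on `ℤ_T × (ℤ/S)³` with 't Hooft twist `n` and flavour twist `F`**:
`⟨X⟩_{n,F} = I_{n,F}(X) / Z_{n,F}` — `qcdSlabExpect` with the corner plaquette of every plane
twisted and colour–flavour-twisted quark seams (junk `0` if `Z_{n,F} = 0`). [cite: GarciaperezGonzalezarroyoOkawa2014, §6] [cite: LinOgawaRamos2015, §2.1] -/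
def twistedSlabExpect (β : ℝ) (T S : ℕ) [NeZero T] [NeZero S] (n : SlabPlane 3 → ZMod 3)
    (F : SlabFlavourTwist Nf) (mq : Fin Nf → ℝ)
    (X : FiniteTemperature.Config 3 T S 𝔾 → SlabFermiAlg Nf T S) : ℂ :=
  twistedSlabIntegral β T S n F mq X / twistedSlabPartition β T S n F mq

/-- **Request (2): the trivial twist gives `qcdSlabExpect`.** [folklore] -/
theorem twistedSlabExpect_zero_one (β : ℝ) (T S : ℕ) [NeZero T] [NeZero S] (mq : Fin Nf → ℝ)
    (X : FiniteTemperature.Config 3 T S 𝔾 → SlabFermiAlg Nf T S) :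
    twistedSlabExpect β T S 0 (1 : SlabFlavourTwist Nf) mq X = qcdSlabExpect β T S mq X := by
  simp only [twistedSlabExpect, twistedSlabIntegral, twistedSlabPartition, qcdSlabExpect,
    qcdSlabPartition, slabTwistOfTensor_zero, slabTwistedWeight_one, twistedSlabBoltzmann_one, one_mul]

/-- The unnormalised twisted functional with trivial twists is the numerator of `qcdSlabExpect`. [folklore] -/
theorem twistedSlabPartition_zero_one (β : ℝ) (T S : ℕ) [NeZero T] [NeZero S] (mq : Fin Nf → ℝ) :
    twistedSlabPartition β T S 0 (1 : SlabFlavourTwist Nf) mq = qcdSlabPartition β T S mq := by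
  simp only [twistedSlabIntegral, twistedSlabPartition, qcdSlabPartition, slabTwistOfTensor_zero,
    slabTwistedWeight_one, twistedSlabBoltzmann_one, one_mul]

/-- The expectation of the unit is `1` whenever the twisted partition function does not vanish. [folklore] -/
theorem twistedSlabExpect_one (β : ℝ) (T S : ℕ) [NeZero T] [NeZero S] (n : SlabPlane 3 → ZMod 3)
    (F : SlabFlavourTwist Nf) (mq : Fin Nf → ℝ) (hZ : twistedSlabPartition β T S n F mq ≠ 0) :
    twistedSlabExpect β T S n F mq (fun _ => 1) = 1 :=
  div_self hZ

/-- **Request (1), `N_f = 0`: the twisted functional of a gluonic observable is a reweighted Wilson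
integral** — with no quark variables `I_n(F) = ∫ F(U) e^{−S_n(U)} ∏dU`, and `e^{−S_n}` is the
Wilson weight times the corner reweighting factor (`slabTwistedWeight_slabTwistOfTensor`). [folklore] -/
theorem twistedSlabIntegral_of_isEmpty (β : ℝ) (T S : ℕ) [NeZero T] [NeZero S] (n : SlabPlane 3 → ZMod 3)
    (F : SlabFlavourTwist 0) (mq : Fin 0 → ℝ) (Fobs : FiniteTemperature.Config 3 T S 𝔾 → ℂ) :
    twistedSlabIntegral β T S n F mq (fun U => algebraMap ℂ (SlabFermiAlg 0 T S) (Fobs U)) =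
      ∫ U, Fobs U * ((slabTwistedWeight (fundamentalRep (Fin 3)) (slabTwistOfTensor 3 n) β β U : ℝ) : ℂ)
        ∂(FiniteTemperature.haar 3 T S 𝔾) := by
  simp only [twistedSlabIntegral, twistedSlabBoltzmann_zero, mul_one]
  refine integral_congr_ae (Filter.Eventually.of_forall fun U => ?_)
  simp only
  rw [Algebra.algebraMap_eq_smul_one, map_smul, slabFermiIntegral_one, smul_eq_mul, mul_one]

/-- `N_f = 0`: the twisted partition function is the (positive) pure-gauge one. [folklore] -/
theorem twistedSlabPartition_of_isEmpty (β : ℝ) (T S : ℕ) [NeZero T] [NeZero S] (n : SlabPlane 3 → ZMod 3)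
    (F : SlabFlavourTwist 0) (mq : Fin 0 → ℝ) :
    twistedSlabPartition β T S n F mq =
      ((∫ U, slabTwistedWeight (fundamentalRep (Fin 3)) (slabTwistOfTensor 3 n) β β U
        ∂(FiniteTemperature.haar 3 T S 𝔾) : ℝ) : ℂ) := by
  have h := twistedSlabIntegral_of_isEmpty β T S n F mq fun _ => 1
  simp only [map_one, one_mul] at h
  rw [twistedSlabPartition, h, integral_complex_ofReal]

/-- `N_f = 0`: the twisted partition function does not vanish (it is positive). [folklore] -/
theorem twistedSlabPartition_of_isEmpty_ne_zero (β : ℝ) (T S : ℕ) [NeZero T] [NeZero S]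
    (n : SlabPlane 3 → ZMod 3) (F : SlabFlavourTwist 0) (mq : Fin 0 → ℝ) :
    twistedSlabPartition β T S n F mq ≠ 0 := by
  rw [twistedSlabPartition_of_isEmpty, Complex.ofReal_ne_zero]
  exact (integral_slabTwistedWeight_pos _ (continuous_fundamentalRep (Fin 3)) _ β β).ne'

/-- Non-vacuity: at `β = 0` and `N_f = 0` every twisted partition function equals `1` (the Haar
measure is a probability measure). [folklore] -/
theorem twistedSlabPartition_of_isEmpty_beta_zero (T S : ℕ) [NeZero T] [NeZero S]
    (n : SlabPlane 3 → ZMod 3) (F : SlabFlavourTwist 0) (mq : Fin 0 → ℝ) :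
    twistedSlabPartition 0 T S n F mq = 1 := by
  rw [twistedSlabPartition_of_isEmpty]
  simp

/-- **The electric-flux selection rule in the `N_f = 0` twisted functional**: a gluonic
observable covariant with a non-trivial character under the spatial centre transformation of
direction `i` (`F(c·U) = ω F(U)`, `ω ≠ 1`, `c ∈ Z(SU(3))`) has `I_n(F) = 0` for every twist
tensor `n` — flux-carrying observables (Polyakov loops winding direction `i`) vanish in every
twisted ensemble, so only flux-neutral observables are admissible in the femto-universe statement. [cite: GarciaperezGonzalezarroyoOkawa2014, §5.1] [cite: Vanbaal2001, §3.4] -/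
theorem twistedSlabIntegral_eq_zero_of_covariant (β : ℝ) (T S : ℕ) [NeZero T] [NeZero S]
    (n : SlabPlane 3 → ZMod 3) (Fl : SlabFlavourTwist 0) (mq : Fin 0 → ℝ) {c : 𝔾}
    (hc : c ∈ Subgroup.center 𝔾) (i : Fin 3) {Fobs : FiniteTemperature.Config 3 T S 𝔾 → ℂ} {ω : ℂ}
    (hω : ω ≠ 1) (hF : ∀ U, Fobs (spatialCentreMul i c U) = ω * Fobs U) :
    twistedSlabIntegral β T S n Fl mq (fun U => algebraMap ℂ (SlabFermiAlg 0 T S) (Fobs U)) = 0 := by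
  rw [twistedSlabIntegral_of_isEmpty]
  exact integral_mul_slabTwistedWeight_eq_zero_of_covariant _ hc i _ β β hω hF

/-! ### The electric-flux projections -/

/-- **The electric-flux-projected unnormalised functional** at spatial (magnetic) twist `m` and
electric flux `e ∈ ℤ₃³`: the `ℤ₃`-Fourier transform over the temporal twists,
`Σ_{k : Fin 3 → ZMod 3} χ_e(k)⁻¹ I_{(k,m),Φ_k}(X)`, `χ_e(k)⁻¹ = e^{−2πi k·e/3} = centerPhase 3 (−k·e)`
('t Hooft: `e^{−F(e,m)/T} = N⁻³ Σ_k e^{−2πi k·e/N} Z(k,m)`; the common factor `N⁻³` cancels in the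
normalised functional). The flavour twist may depend on the temporal twist (`Φ k`; vacuous at
`N_f = 0`). [cite: ForcrandSmekal2002, §"Twisted Boundary Conditions and Electric Fluxes" (e^{−F(e,m,θ)/T} = N⁻³Σ e^{−iω}Z(k,m,ν))] [cite: Vanbaal2001, §3.1] -/
def fluxProjectedSlabIntegral (β : ℝ) (T S : ℕ) [NeZero T] [NeZero S] (m : Plane 3 → ZMod 3)
    (e : Fin 3 → ZMod 3) (Φ : (Fin 3 → ZMod 3) → SlabFlavourTwist Nf) (mq : Fin Nf → ℝ)
    (X : FiniteTemperature.Config 3 T S 𝔾 → SlabFermiAlg Nf T S) : ℂ :=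
  ∑ k : Fin 3 → ZMod 3, centerPhase 3 (-(∑ i, k i * e i)) *
    twistedSlabIntegral β T S (Sum.elim k m) (Φ k) mq X

/-- **The electric-flux-projected expectation** `⟨X⟩_{e,m} = (Σ_k χ_e(k)⁻¹ Z_{(k,m)}⟨X⟩_{(k,m)}) /
(Σ_k χ_e(k)⁻¹ Z_{(k,m)})` — the thermal expectation of the spatial twisted box `(ℤ/S)³` with
magnetic flux `m` restricted to the sector of electric flux `e` (junk `0` on a vanishing
denominator). [cite: ForcrandSmekal2002, §"Twisted Boundary Conditions and Electric Fluxes" (Z_e(e⃗) = Σ_k e^{−2πi e⃗·k⃗/N} Z_k(k⃗)/Σ_k Z_k(k⃗))] [cite: Vanbaal2001, §3.1] -/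
def fluxProjectedSlabExpect (β : ℝ) (T S : ℕ) [NeZero T] [NeZero S] (m : Plane 3 → ZMod 3)
    (e : Fin 3 → ZMod 3) (Φ : (Fin 3 → ZMod 3) → SlabFlavourTwist Nf) (mq : Fin Nf → ℝ)
    (X : FiniteTemperature.Config 3 T S 𝔾 → SlabFermiAlg Nf T S) : ℂ :=
  fluxProjectedSlabIntegral β T S m e Φ mq X / fluxProjectedSlabIntegral β T S m e Φ mq fun _ => 1

/-- **The partial electric-flux projection along one spatial direction `i`**: starting from a base
twist tensor `n`, average the unnormalised functionals over the temporal twist `k_i = n_{0i} ∈ ℤ₃`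
of the plane `(0, i)` only, with the character `e^{−2πi k_i e_i/3}`; this fixes the flux `e_i`
through direction `i` and keeps all transverse fluxes (they stay in the thermal trace). [cite: Vanbaal2001, §3.1 and §3.4] [cite: ForcrandSmekal2002, §"Twisted Boundary Conditions and Electric Fluxes"] -/
def partialFluxProjectedSlabIntegral (β : ℝ) (T S : ℕ) [NeZero T] [NeZero S] (i : Fin 3) (e : ZMod 3)
    (n : SlabPlane 3 → ZMod 3) (Φ : ZMod 3 → SlabFlavourTwist Nf) (mq : Fin Nf → ℝ)
    (X : FiniteTemperature.Config 3 T S 𝔾 → SlabFermiAlg Nf T S) : ℂ :=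
  ∑ k : ZMod 3, centerPhase 3 (-(k * e)) *
    twistedSlabIntegral β T S (Function.update n (Sum.inl i) k) (Φ k) mq X

/-- The partially flux-projected expectation along direction `i` at flux `e_i`:
`(Σ_{k_i} e^{−2πik_ie_i/3} I_{n[k_i]}(X)) / (Σ_{k_i} e^{−2πik_ie_i/3} I_{n[k_i]}(1))`. For `e_i = 0`
this is the plain average over the three temporal twists of the plane `(0, i)` — the `e₃ = 0`
frame of the route `FemtoStepScaling`. [cite: Vanbaal2001, §3.1 and §3.4] -/
def partialFluxProjectedSlabExpect (β : ℝ) (T S : ℕ) [NeZero T] [NeZero S] (i : Fin 3) (e : ZMod 3)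
    (n : SlabPlane 3 → ZMod 3) (Φ : ZMod 3 → SlabFlavourTwist Nf) (mq : Fin Nf → ℝ)
    (X : FiniteTemperature.Config 3 T S 𝔾 → SlabFermiAlg Nf T S) : ℂ :=
  partialFluxProjectedSlabIntegral β T S i e n Φ mq X /
    partialFluxProjectedSlabIntegral β T S i e n Φ mq fun _ => 1

/-! ### The data of the route `FemtoStepScaling`: spatial twist `n₁₂ = 1`, temporal twist `n₀₃ = k` -/

/-- The base twist tensor of the femto-universe statement: spatial (magnetic) twist `n₁₂ = 1` in
the plane of the spatial directions `0, 1` (`m = (0, 0, 1)`), no other twist. [folklore] -/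
def femtoBaseTwist : SlabPlane 3 → ZMod 3 :=
  Sum.elim 0 fun p => if p.1 = (0, 1) then 1 else 0

/-- The base tensor has no temporal twist. [folklore] -/
@[simp] theorem femtoBaseTwist_inl (i : Fin 3) : femtoBaseTwist (Sum.inl i) = 0 := rfl

/-- The base tensor twists exactly the spatial plane of directions `0, 1`. [folklore] -/
theorem femtoBaseTwist_inr (p : Plane 3) :
    femtoBaseTwist (Sum.inr p) = if p.1 = (0, 1) then 1 else 0 := rfl

/-- **The route's reweighting factor `Tw k`**, verbatim (with `β` for `afBeta 0 Λ (ℓ/S)`): the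
exponential of `β` times the sum over sites of the spatial corner term (plane of directions `0, 1`,
phase `ω̄ = centerPhase 3 (−1)`) plus the temporal corner term (plane `(0, 3)`, i.e. time and
spatial direction `2`, phase `centerPhase 3 (−k)`). [folklore] -/
def femtoTwistWeight (β : ℝ) (k : ZMod 3) (U : FiniteTemperature.Config 3 T S 𝔾) : ℝ :=
  Real.exp (β * ∑ x : FiniteTemperature.Site 3 T S,
    ((if x.2 0 = -1 ∧ x.2 1 = -1 then
        ((centerPhase 3 (-1) *
            ((fundamentalRep (Fin 3)) (FiniteTemperature.plaquette U x (some 0) (some 1))).trace).re -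
          ((fundamentalRep (Fin 3)) (FiniteTemperature.plaquette U x (some 0) (some 1))).trace.re)
      else 0) +
      (if x.1 = -1 ∧ x.2 2 = -1 then
        ((centerPhase 3 (-k) *
            ((fundamentalRep (Fin 3)) (FiniteTemperature.plaquette U x none (some 2))).trace).re -
          ((fundamentalRep (Fin 3)) (FiniteTemperature.plaquette U x none (some 2))).trace.re)
      else 0)))

/-- **The twisted weight of the route's tensor is the Wilson weight times the route's `Tw k`**:
`e^{−S_{n}} = e^{−S_W} · Tw k` for `n = femtoBaseTwist[n₀₃ ↦ k]`. [folklore] -/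
theorem slabTwistedWeight_femto (β : ℝ) (k : ZMod 3) (U : FiniteTemperature.Config 3 T S 𝔾) :
    slabTwistedWeight (fundamentalRep (Fin 3))
        (slabTwistOfTensor 3 (Function.update femtoBaseTwist (Sum.inl 2) k)) β β U =
      FiniteTemperature.weight (fundamentalRep (Fin 3)) β β U * femtoTwistWeight β k U := by
  rw [slabTwistedWeight_slabTwistOfTensor, femtoTwistWeight]
  congr 2
  rw [← mul_add, ← Finset.sum_add_distrib]
  congr 1
  refine Finset.sum_congr rfl fun x _ => ?_
  rw [add_comm]
  congr 1
  · -- the spatial planes: only `(0, 1)` is twisted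
    rw [Finset.sum_eq_single (⟨(0, 1), by decide⟩ : Plane 3)]
    · simp [femtoBaseTwist_inr]
    · intro p _ hp
      have hp1 : p.1 ≠ (0, 1) := fun h => hp (Subtype.ext h)
      simp [femtoBaseTwist_inr, hp1]
    · intro h; exact absurd (Finset.mem_univ _) h
  · -- the temporal planes: only `(0, 3)` (spatial direction `2`) is twisted
    rw [Finset.sum_eq_single (2 : Fin 3)]
    · simp
    · intro i _ hi
      simp [hi]
    · intro h; exact absurd (Finset.mem_univ _) h

/-- **Request (1): the route's functional `Ex` is the partially flux-projected twisted slab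
expectation at `N_f = 0`.** For a real gluonic observable `F` (embedded as a scalar of the empty
Grassmann algebra), the `e₃ = 0` projection along direction `2` of the twist `n₁₂ = 1`:
`partialFluxProjectedSlabExpect β T S 2 0 femtoBaseTwist Φ mq F =
(Σ_k ⟨F · Tw k⟩_β) / (Σ_k ⟨Tw k⟩_β)`, `⟨·⟩_β = FiniteTemperature.expectation ρ β β` — literally the
inline `Ex` of `Summit.QuantumFields.QCD.Theses.FemtoStepScaling.FemtoUniverseGapR` (with
`β = afBeta 0 Λ (ℓ/S)`). [folklore] -/
theorem partialFluxProjectedSlabExpect_femto (β : ℝ) (T S : ℕ) [NeZero T] [NeZero S]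
    (Φ : ZMod 3 → SlabFlavourTwist 0) (mq : Fin 0 → ℝ) (Fobs : FiniteTemperature.Config 3 T S 𝔾 → ℝ) :
    partialFluxProjectedSlabExpect β T S 2 0 femtoBaseTwist Φ mq
        (fun U => algebraMap ℂ (SlabFermiAlg 0 T S) (Fobs U : ℂ)) =
      (((∑ k : ZMod 3, FiniteTemperature.expectation (fundamentalRep (Fin 3)) β β
            (fun U : FiniteTemperature.Config 3 T S 𝔾 => Fobs U * femtoTwistWeight β k U)) /
          (∑ k : ZMod 3, FiniteTemperature.expectation (L₀ := T) (L := S) (fundamentalRep (Fin 3)) β β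
            (femtoTwistWeight β k)) : ℝ) : ℂ) := by
  have hZ : (∫ U, FiniteTemperature.weight (fundamentalRep (Fin 3)) β β U
      ∂(FiniteTemperature.haar 3 T S 𝔾)) ≠ 0 :=
    (FiniteTemperature.partitionFunction_pos _ (continuous_fundamentalRep (Fin 3)) β β).ne'
  have hnum : ∀ (k : ZMod 3) (Gobs : FiniteTemperature.Config 3 T S 𝔾 → ℝ),
      twistedSlabIntegral β T S (Function.update femtoBaseTwist (Sum.inl 2) k) (Φ k) mq
        (fun U => algebraMap ℂ (SlabFermiAlg 0 T S) (Gobs U : ℂ)) =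
      ((∫ U, Gobs U * femtoTwistWeight β k U * FiniteTemperature.weight (fundamentalRep (Fin 3)) β β U
        ∂(FiniteTemperature.haar 3 T S 𝔾) : ℝ) : ℂ) := by
    intro k Gobs
    rw [twistedSlabIntegral_of_isEmpty, ← integral_complex_ofReal]
    refine integral_congr_ae (Filter.Eventually.of_forall fun U => ?_)
    simp only [slabTwistedWeight_femto]
    push_cast
    ring
  have hden : ∀ k : ZMod 3,
      twistedSlabIntegral β T S (Function.update femtoBaseTwist (Sum.inl 2) k) (Φ k) mq (fun _ => 1) =
      ((∫ U, femtoTwistWeight β k U * FiniteTemperature.weight (fundamentalRep (Fin 3)) β β U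
        ∂(FiniteTemperature.haar 3 T S 𝔾) : ℝ) : ℂ) := by
    intro k
    have h1 : (fun (_ : FiniteTemperature.Config 3 T S 𝔾) => (1 : SlabFermiAlg 0 T S)) =
        fun U => algebraMap ℂ (SlabFermiAlg 0 T S) ((fun _ => (1 : ℝ)) U : ℂ) := by
      funext U; simp
    rw [h1, hnum k]
    simp only [one_mul]
  simp only [partialFluxProjectedSlabExpect, partialFluxProjectedSlabIntegral, mul_zero, neg_zero,
    centerPhase_zero', one_mul, hnum _ Fobs, hden, FiniteTemperature.expectation]
  push_cast
  rw [← Finset.sum_div, ← Finset.sum_div, div_div_div_cancel_right₀ (Complex.ofReal_ne_zero.2 hZ)]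

/-! ### Connected Euclidean-time correlators (request (4)) -/

/-- **The connected Euclidean-time correlation of a slab functional `E`**:
`E(A(0)·B(n e₀)) − E(A(0)) E(B(n e₀))` for gauge-invariant local lattice QCD observables `A, B`
placed on the anisotropic torus (`QCDLatticeObservable.onSlab`), `B` translated by `n` lattice units
in Euclidean time. `E = qcdSlabExpect β T S mq` gives `qcdSlabConnectedCorr`
(`slabConnectedCorr_qcdSlabExpect`); the twisted and flux-projected functionals give the twins
below. [cite: OsterwalderSeiler1978, §§2–4] [cite: MontvayMunster1994, §5.2.1 (5.92)] -/
def slabConnectedCorr {R R' : ℕ} (E : (FiniteTemperature.Config 3 T S 𝔾 → SlabFermiAlg Nf T S) → ℂ)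
    (A : QCDLatticeObservable Nf R) (B : QCDLatticeObservable Nf R') (n : ℕ) : ℂ :=
  E (fun U => A.onSlab T S 0 U * B.onSlab T S (Pi.single 0 (n : ℤ)) U) -
    E (A.onSlab T S 0) * E (B.onSlab T S (Pi.single 0 (n : ℤ)))

/-- For `E = qcdSlabExpect` the generic correlator is `qcdSlabConnectedCorr` (definitionally). [folklore] -/
theorem slabConnectedCorr_qcdSlabExpect {R R' : ℕ} (β : ℝ) (mq : Fin Nf → ℝ)
    (A : QCDLatticeObservable Nf R) (B : QCDLatticeObservable Nf R') (n : ℕ) :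
    slabConnectedCorr (qcdSlabExpect β T S mq) A B n = qcdSlabConnectedCorr β T S mq A B n := rfl

/-- **The time correlator on the torus is `T`-periodic in the separation**, for every functional. [cite: MontvayMunster1994, §5.2.1 (5.92)–(5.93)] -/
theorem slabConnectedCorr_add_period {R R' : ℕ}
    (E : (FiniteTemperature.Config 3 T S 𝔾 → SlabFermiAlg Nf T S) → ℂ)
    (A : QCDLatticeObservable Nf R) (B : QCDLatticeObservable Nf R') (n : ℕ) :
    slabConnectedCorr E A B (n + T) = slabConnectedCorr E A B n := by
  have h : (Pi.single 0 ((n + T : ℕ) : ℤ) : Fin 4 → ℤ) = Pi.single 0 (n : ℤ) + Pi.single 0 (T : ℤ) := by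
    rw [Nat.cast_add, Pi.single_add]
  simp only [slabConnectedCorr, h, QCDLatticeObservable.onSlab_add_period]

/-- If `E 1 = 1` the unit observable is uncorrelated with everything. [folklore] -/
theorem slabConnectedCorr_one_left {R R' : ℕ}
    (E : (FiniteTemperature.Config 3 T S 𝔾 → SlabFermiAlg Nf T S) → ℂ) (hE : E (fun _ => 1) = 1)
    (B : QCDLatticeObservable Nf R') (n : ℕ) :
    slabConnectedCorr E (QCDLatticeObservable.one Nf R) B n = 0 := by
  have h1 : (QCDLatticeObservable.one Nf R).onSlab T S 0 =
      fun _ : FiniteTemperature.Config 3 T S 𝔾 => (1 : SlabFermiAlg Nf T S) :=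
    funext fun U => QCDLatticeObservable.onSlab_one T S 0 U
  have h2 : (fun U => (QCDLatticeObservable.one Nf R).onSlab T S 0 U *
      B.onSlab T S (Pi.single 0 (n : ℤ)) U) = B.onSlab T S (Pi.single 0 (n : ℤ)) := by
    funext U; rw [QCDLatticeObservable.onSlab_one, one_mul]
  unfold slabConnectedCorr
  rw [h2, h1, hE, one_mul, sub_self]

/-- **Connected time correlator of twisted lattice QCD on `ℤ_T × (ℤ/S)³`** (twist tensor `n`,
flavour twist `F`): the twin of `qcdSlabConnectedCorr`. [cite: OsterwalderSeiler1978, §§2–4] -/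
abbrev twistedSlabConnectedCorr {R R' : ℕ} (β : ℝ) (T S : ℕ) [NeZero T] [NeZero S]
    (n : SlabPlane 3 → ZMod 3) (F : SlabFlavourTwist Nf) (mq : Fin Nf → ℝ)
    (A : QCDLatticeObservable Nf R) (B : QCDLatticeObservable Nf R') (k : ℕ) : ℂ :=
  slabConnectedCorr (twistedSlabExpect β T S n F mq) A B k

/-- **Connected time correlator in the electric-flux sector `e` at magnetic twist `m`.** [cite: Vanbaal2001, §3.1] -/
abbrev fluxProjectedSlabConnectedCorr {R R' : ℕ} (β : ℝ) (T S : ℕ) [NeZero T] [NeZero S]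
    (m : Plane 3 → ZMod 3) (e : Fin 3 → ZMod 3) (Φ : (Fin 3 → ZMod 3) → SlabFlavourTwist Nf)
    (mq : Fin Nf → ℝ) (A : QCDLatticeObservable Nf R) (B : QCDLatticeObservable Nf R') (k : ℕ) : ℂ :=
  slabConnectedCorr (fluxProjectedSlabExpect β T S m e Φ mq) A B k

/-- **Connected time correlator in the partially projected frame** (flux `e_i` along direction `i`
fixed; the femto-universe observable of `FemtoUniverseGapR` for `i = 2`, `e_i = 0`,
`n = femtoBaseTwist`, `N_f = 0`). [cite: Vanbaal2001, §3.1 and §3.4] -/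
abbrev partialFluxProjectedSlabConnectedCorr {R R' : ℕ} (β : ℝ) (T S : ℕ) [NeZero T] [NeZero S]
    (i : Fin 3) (e : ZMod 3) (n : SlabPlane 3 → ZMod 3) (Φ : ZMod 3 → SlabFlavourTwist Nf)
    (mq : Fin Nf → ℝ) (A : QCDLatticeObservable Nf R) (B : QCDLatticeObservable Nf R') (k : ℕ) : ℂ :=
  slabConnectedCorr (partialFluxProjectedSlabExpect β T S i e n Φ mq) A B k

end Functional

end Literature.MathematicalPhysics.QuantumFieldTheory

end
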